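import Literature.NumberTheory.EllipticCurves.NewformsEigenformDegeneracySpanProofs
import Literature.NumberTheory.EllipticCurves.CuspFormLFunctionNewformFrickeProofs
import Literature.NumberTheory.EllipticCurves.CuspFormLFunctionLevelConductorProofs
import Literature.NumberTheory.EllipticCurves.CuspFormLFunctionEulerProductProofs
import Literature.NumberTheory.EllipticCurves.AtkinLehnerInvolutionsProofs
import Literature.NumberTheory.EllipticCurves.NewformsRealCoefficients
import HarnessLib

/-!
# A normalised eigenform on `Γ₀(N)` whose completed `L`-function satisfies Hecke's functional equation AT LEVEL `N`
# (self-dual, `Λ_N(s) = W·Λ_N(k − s)`) is a NEWFORM — Li's criterion, proved from Atkin–Lehner theory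

Topic `NumberTheory/EllipticCurves`; namespace `Literature.NumberTheory.EllipticCurves.ModularForms`.  A `…Proofs` file
(theorems only: no definition, no named fact, no instance; D-0026), sequel of `NewformsEigenformDegeneracySpanProofs`
(`exists_cuspCoeff_eq_sum_of_eigenpacket`: an eigenform with the packet of a newform `h` of level `M ∣ N` is
`Σ_{d ∣ N/M} c_d h(dτ)`), `CuspFormLFunctionNewformFrickeProofs` (`IsNewform0.exists_functional_equation_holds`: Hecke's
functional equation `Λ_M(h, s) = i^k ε Λ_M(h, k − s)` of a newform), `CuspFormLFunctionEulerProductProofs`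
(`IsNewform0.cuspCoeff_prime_pow_add_two_weight`, the prime-power Hecke recursion) and `CuspFormLFunctionLevelConductorProofs` /
`AtkinLehnerInvolutionsProofs` (Atkin–Lehner's Thm. 3 at every weight: `a_ℓ(h) = 0` if `ℓ² ∣ M`, `a_ℓ(h) = −ℓ^{k/2−1}λ_ℓ`,
`λ_ℓ = ±1`, if `ℓ ∥ M`).

THE THEOREM (W.-C. W. Li, *Newforms and functional equations*, Math. Ann. 212 (1975), Thm. 9 with Thm. 3 (ii)–(iii);
Miyake, *Modular Forms*, Thm. 4.6.17 / Cor. 4.6.22; Atkin–Lehner 1970, Thms. 3–5 — the "converse" half of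
Atkin–Lehner–Li theory: oldforms that are eigenforms of every Hecke operator cannot satisfy the functional equation of
level `N`).  Let `g ∈ S_k(Γ₀(N))` be normalised (`a₁ = 1`) with the `T_p`-eigenvalues (`p ∤ N`) of a newform
`h ∈ S_k(Γ₀(M))`, `M ∣ N`; suppose its Fourier coefficients are multiplicative, that at every prime `ℓ ∣ N` they are
geometric (`a_{ℓ^j}(g) = a_ℓ(g)^j`, i.e. `g` is a `U_ℓ`-eigenvector) with `‖a_ℓ(g)‖² ≠ ℓ^{k−2}`, and that the
completed `L`-function `Λ_N(g, s) = N^{s/2}(2π)^{−s}Γ(s)L(g, s)` has an entire continuation with `Λ(s) = W·Λ(k − s)`.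
THEN `M = N` and `g = h`; in particular `g` is a newform:

* ★ `level_eq_of_functionalEquation` (`N = M`), ★ `eq_newform_of_functionalEquation` (`g = h` once `M = N`),
  ★★ `isNewform0_of_functionalEquation`.

PROOF (kernel-checked below; elementary given the three tree inputs, NO Ramanujan bound needed).  Write
`a(g) = c ⋆ a(h)` with `c` supported on the divisors of `Q = N/M` (the Atkin–Lehner span; `c` may be taken MULTIPLICATIVE
since `a(g)`, `a(h)` are — `exists_isMultiplicative_convolution_eq`), so `L(g,s) = P(s)L(h,s)` with the Dirichlet POLYNOMIAL
`P(s) = Σ_{d ∣ Q} c_d d^{−s}` and `Λ_N(g,s) = Q^{s/2}P(s)Λ_M(h,s)`.  Dividing the two functional equations (the entire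
`Λ_M(h,·)` is not identically zero) gives `Q^{s}P(s) = C·P(k−s)` for all `s`, i.e. `Σ_{d∣Q}(c_{Q/d} − C c_d d^{−k}) d^{s} ≡ 0`,
whence (injectivity of Dirichlet series) `c_{Q/d} = C c_d d^{−k}`, so `C² = Q^k` and, prime by prime,
**`c_{ℓ^e}² = ℓ^{ke}`** for `e = v_ℓ(Q)`.  Locally at `ℓ` the three generating series `Σ a_{ℓ^j}(g)T^j = (1 − bT)⁻¹`
(`b = a_ℓ(g)`), `Σ a_{ℓ^j}(h)T^j = A(T)⁻¹` (`A = 1 − a_ℓ(h)T + 𝟙_{ℓ∤M}ℓ^{k−1}T²`, the newform Hecke recursion) and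
`R(T) = Σ_{i ≤ e} c_{ℓ^i}T^i` satisfy `A = R·(1 − bT)`; comparing coefficients: `e ≥ 3` is impossible, `e = 2` forces
`b = 0`, `c_{ℓ²} = ℓ^{k−1}`, contradicting `c_{ℓ²}² = ℓ^{2k}`; `e = 1` forces either `ℓ ∤ M`, `−b c_ℓ = ℓ^{k−1}` with
`‖c_ℓ‖² = ℓ^k`, i.e. `‖b‖² = ℓ^{k−2}` (excluded — this is the Steinberg-type old `U_ℓ`-eigenvalue `±ℓ^{k/2−1}`, the one
loophole of Li's criterion), or `ℓ ∣ M`, `b = 0`, `a_ℓ(h)² = c_ℓ² = ℓ^k`, contradicting Atkin–Lehner's Thm. 3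
(`‖a_ℓ(h)‖² ∈ {0, ℓ^{k−2}}`).  Hence `Q = 1`.

Consumer: the theta series `θ_ψ` of a PRIMITIVE Größencharakter `ψ mod 𝔣` of an imaginary quadratic field — its coefficients
are multiplicative, geometric at the level primes with `‖ψ(𝔭)‖² = ℓ^{k−1} ≠ ℓ^{k−2}`, and `Λ(θ_ψ, s) = Λ(ψ, s)` satisfies
Hecke's (1920) functional equation with conductor `|d_K|·N𝔣` — is a newform of level EXACTLY `|d_K|·N𝔣`
(`CMNewformGamma0PrimitiveIsNewformProofs.lean`; Shimura 1971/72, Miyake Thm. 4.8.2).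

`lean search 'isNewform0_of|IsNewform0_of|of_functionalEquation'` (2026-08-31): no declaration concluding `IsNewform0`
from a functional equation.

## References
* [Li1975] W.-C. W. Li, *Newforms and functional equations*, Math. Ann. 212 (1975), 285–315, Thm. 3, Thm. 9.
* [AtkinLehner1970] A. O. L. Atkin, J. Lehner, *Hecke operators on `Γ₀(m)`*, Math. Ann. 185 (1970), Thms. 3, 4, 5.
* [Miyake2006] T. Miyake, *Modular Forms*, Springer (1989/2006), §4.6, Thm. 4.6.17, and Thm. 4.8.2.
* [DiamondShurman2005] F. Diamond, J. Shurman, *A first course in modular forms*, §5.8–§5.10.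
-/

noncomputable section

open scoped MatrixGroups ModularForm LSeries.notation
open CongruenceSubgroup Complex Finset

namespace Literature.NumberTheory.EllipticCurves.ModularForms

/-! ## §1. Arithmetic preliminaries: a multiplicative Dirichlet quotient -/

/-- **Multiplicative extension of prime-power data.** For `c₀ : ℕ → ℂ` with `c₀ 1 = 1` there is a multiplicative
`c' : ℕ → ℂ` (`c' 0 = 0`, `c'(mn) = c'(m)c'(n)` for coprime `m, n`) with `c'(p^e) = c₀(p^e)` at every prime power
(`c'(n) = ∏_{p^e ∥ n} c₀(p^e)`). [folklore] -/
private theorem exists_isMultiplicative_prime_pow_eq (c₀ : ℕ → ℂ) (h1 : c₀ 1 = 1) :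
    ∃ c' : ℕ → ℂ, ArithmeticFunction.IsMultiplicative (toArithmeticFunction c') ∧ c' 0 = 0 ∧
      ∀ p e : ℕ, p.Prime → c' (p ^ e) = c₀ (p ^ e) := by
  classical
  refine ⟨fun n ↦ if n = 0 then 0 else n.factorization.prod fun p e ↦ c₀ (p ^ e), ?_, if_pos rfl, ?_⟩
  · refine ⟨?_, ?_⟩
    · simp [toArithmeticFunction]
    · intro m n hmn
      rcases Nat.eq_zero_or_pos m with rfl | hm
      · simp [toArithmeticFunction]
      rcases Nat.eq_zero_or_pos n with rfl | hn
      · simp [toArithmeticFunction]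
      have hmn0 : m * n ≠ 0 := Nat.mul_ne_zero hm.ne' hn.ne'
      simp only [toArithmeticFunction, ArithmeticFunction.coe_mk, hmn0, hm.ne', hn.ne', if_false]
      rw [Nat.factorization_mul_of_coprime hmn, Finsupp.prod_add_index_of_disjoint]
      rw [Nat.support_factorization, Nat.support_factorization]
      exact hmn.disjoint_primeFactors
  · intro p e hp
    have hpe : p ^ e ≠ 0 := pow_ne_zero _ hp.ne_zero
    simp only [hpe, if_false, hp.factorization_pow]
    rw [Finsupp.prod_single_index]
    rw [pow_zero, h1]

/-- `Σ_{(d,d') : d d' = p^e} F(d, d') = Σ_{i ≤ e} F(p^i, p^{e−i})` for a prime power. [folklore] -/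
private theorem sum_divisorsAntidiagonal_prime_pow {M : Type*} [AddCommMonoid M] {p : ℕ} (hp : p.Prime) (e : ℕ)
    (F : ℕ × ℕ → M) :
    ∑ x ∈ (p ^ e).divisorsAntidiagonal, F x = ∑ i ∈ range (e + 1), F (p ^ i, p ^ (e - i)) := by
  rw [Nat.sum_divisorsAntidiagonal fun a b ↦ F (a, b), Nat.divisors_prime_pow hp, Finset.sum_map]
  refine Finset.sum_congr rfl fun i hi ↦ ?_
  simp only [Function.Embedding.coeFn_mk]
  rw [Nat.pow_div (Nat.lt_succ_iff.mp (mem_range.mp hi)) hp.pos]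

/-- **A multiplicative sequence whose prime-power generating series factor through those of a multiplicative `b` is a
Dirichlet convolution `c' ⋆ b` with `c'` MULTIPLICATIVE.** If `a`, `b` are multiplicative (`toArithmeticFunction`) and at
every prime power `a(p^e) = Σ_{i ≤ e} c₀(p^i) b(p^{e−i})` (`c₀ 1 = 1`), then `a(n) = (c' ⋆ b)(n)` (`n ≥ 1`) for the
multiplicative `c'` with `c'(p^e) = c₀(p^e)` (two multiplicative functions agreeing on prime powers agree). [folklore] -/
private theorem exists_isMultiplicative_convolution_eq {a b c₀ : ℕ → ℂ} (ha : ArithmeticFunction.IsMultiplicative (toArithmeticFunction a))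
    (hb : ArithmeticFunction.IsMultiplicative (toArithmeticFunction b)) (hc1 : c₀ 1 = 1)
    (h : ∀ p e : ℕ, p.Prime → a (p ^ e) = ∑ i ∈ range (e + 1), c₀ (p ^ i) * b (p ^ (e - i))) :
    ∃ c' : ℕ → ℂ, ArithmeticFunction.IsMultiplicative (toArithmeticFunction c') ∧ c' 0 = 0 ∧
      (∀ p e : ℕ, p.Prime → c' (p ^ e) = c₀ (p ^ e)) ∧ ∀ n : ℕ, n ≠ 0 → a n = (c' ⍟ b) n := by
  classical
  obtain ⟨c', hc', hc'0, hc'p⟩ := exists_isMultiplicative_prime_pow_eq c₀ hc1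
  refine ⟨c', hc', hc'0, hc'p, fun n hn ↦ ?_⟩
  have heq : toArithmeticFunction a = toArithmeticFunction c' * toArithmeticFunction b := by
    rw [ArithmeticFunction.IsMultiplicative.eq_iff_eq_on_prime_powers _ ha _ (hc'.mul hb)]
    intro p i hp
    have hpi : p ^ i ≠ 0 := pow_ne_zero _ hp.ne_zero
    rw [ArithmeticFunction.mul_apply, sum_divisorsAntidiagonal_prime_pow hp i]
    simp only [toArithmeticFunction, ArithmeticFunction.coe_mk, hpi, if_false, pow_ne_zero _ hp.ne_zero]
    rw [h p i hp]
    exact Finset.sum_congr rfl fun j _ ↦ by rw [hc'p p j hp]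
  have := congrArg (fun f : ArithmeticFunction ℂ ↦ f n) heq
  simp only [toArithmeticFunction, ArithmeticFunction.coe_mk, hn, if_false] at this
  rw [this, LSeries.convolution]
  simp only [toArithmeticFunction]

/-- The support of the multiplicative `c'`: if `c'(p^e) = 0` unless `p^e ∣ Q` (at every prime power with `e ≥ 1`), then
`c'(n) ≠ 0 ⟹ n ∣ Q` (`n ≥ 1`). [folklore] -/
private theorem dvd_of_isMultiplicative_ne_zero {c' : ℕ → ℂ} (hc' : ArithmeticFunction.IsMultiplicative (toArithmeticFunction c')) {Q : ℕ}
    (hQ : Q ≠ 0) (hsupp : ∀ p e : ℕ, p.Prime → 0 < e → ¬ p ^ e ∣ Q → c' (p ^ e) = 0) {n : ℕ} (hn : n ≠ 0)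
    (hcn : c' n ≠ 0) : n ∣ Q := by
  classical
  rw [← Nat.factorization_le_iff_dvd hn hQ]
  intro p
  by_cases hp : p.Prime
  · by_contra hlt
    have hlt' : Q.factorization p < n.factorization p := not_le.mp hlt
    have he : 0 < n.factorization p := lt_of_le_of_lt (Nat.zero_le _) hlt'
    have hndvd : ¬ p ^ n.factorization p ∣ Q := fun hdvd ↦ by
      have := (hp.pow_dvd_iff_le_factorization hQ).mp hdvd
      omega
    have hzero := hsupp p _ hp he hndvd
    -- `c'(n) = c'(p^{v_p(n)}) · c'(n / p^{v_p(n)})`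
    have hsplit : c' n = c' (ordProj[p] n) * c' (ordCompl[p] n) := by
      have hmul := hc'.map_mul_of_coprime ((Nat.coprime_ordCompl hp hn).pow_left (n.factorization p))
      rw [Nat.ordProj_mul_ordCompl_eq_self] at hmul
      have h1 : ordProj[p] n ≠ 0 := pow_ne_zero _ hp.ne_zero
      have h2 : ordCompl[p] n ≠ 0 := (Nat.ordCompl_pos p hn).ne'
      simpa only [toArithmeticFunction, ArithmeticFunction.coe_mk, hn, h1, h2, if_false] using hmul
    rw [hsplit, hzero, zero_mul] at hcn
    exact hcn rfl
  · rw [Nat.factorization_eq_zero_of_not_prime _ hp]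
    exact Nat.zero_le _

/-! ## §2. The local identity `A = R·(1 − bT)` in `ℂ⟦T⟧` and its coefficients -/

/-- **Local generating series.** Let `r, a_G, a_H : ℕ → ℂ` with `a_G(n) = Σ_{i ≤ n} r(i) a_H(n − i)` (`G = R·H`),
`a_G(n) = b^n` (`(1 − bT)·G = 1`), and `a_H(0) = 1`, `a_H(1) = a`, `a_H(n+2) = a·a_H(n+1) − δ·a_H(n)` (`A·H = 1` for
`A = 1 − aT + δT²`).  Then `R·(1 − bT) = A`, coefficientwise: `r(1) − b·r(0) = −a`, `r(2) − b·r(1) = δ`,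
`r(n+3) − b·r(n+2) = 0`. [folklore] -/
private theorem local_coeff_identities {r aG aH : ℕ → ℂ} {a b dlt : ℂ}
    (hG : ∀ n, aG n = ∑ i ∈ range (n + 1), r i * aH (n - i)) (hB : ∀ n, aG n = b ^ n)
    (hH0 : aH 0 = 1) (hH1 : aH 1 = a) (hHrec : ∀ n, aH (n + 2) = a * aH (n + 1) - dlt * aH n) :
    r 1 - b * r 0 = -a ∧ r 2 - b * r 1 = dlt ∧ ∀ n, r (n + 3) - b * r (n + 2) = 0 := by
  classical
  -- the power series `G = Σ a_G(n)Tⁿ`, `H = Σ a_H(n)Tⁿ`, `R = Σ r(n)Tⁿ`, `B = 1 − bT`, `A = 1 − aT + δT²`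
  set G : PowerSeries ℂ := PowerSeries.mk aG with hGdef
  set H : PowerSeries ℂ := PowerSeries.mk aH with hHdef
  set R : PowerSeries ℂ := PowerSeries.mk r with hRdef
  set B : PowerSeries ℂ := 1 - PowerSeries.C b * PowerSeries.X with hBdef
  set A : PowerSeries ℂ := 1 - PowerSeries.C a * PowerSeries.X + PowerSeries.C dlt * PowerSeries.X ^ 2 with hAdef
  have hGn : ∀ n, PowerSeries.coeff n G = aG n := fun n ↦ by rw [hGdef, PowerSeries.coeff_mk]
  have hHn : ∀ n, PowerSeries.coeff n H = aH n := fun n ↦ by rw [hHdef, PowerSeries.coeff_mk]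
  have hRn : ∀ n, PowerSeries.coeff n R = r n := fun n ↦ by rw [hRdef, PowerSeries.coeff_mk]
  -- coefficients of `φ·B`
  have hcoeffB : ∀ (φ : PowerSeries ℂ) (n : ℕ),
      PowerSeries.coeff (n + 1) (φ * B) = PowerSeries.coeff (n + 1) φ - b * PowerSeries.coeff n φ := by
    intro φ n
    rw [hBdef, mul_sub, mul_one, map_sub, mul_left_comm φ (PowerSeries.C b), PowerSeries.coeff_C_mul,
      mul_comm φ PowerSeries.X, PowerSeries.coeff_succ_X_mul]
  have hcoeffB0 : ∀ φ : PowerSeries ℂ, PowerSeries.coeff 0 (φ * B) = PowerSeries.coeff 0 φ := by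
    intro φ
    rw [hBdef, mul_sub, mul_one, map_sub, mul_left_comm φ (PowerSeries.C b), PowerSeries.coeff_C_mul,
      mul_comm φ PowerSeries.X, PowerSeries.coeff_zero_X_mul, mul_zero, sub_zero]
  -- coefficients of `A·φ`
  have hcoeffA0 : ∀ φ : PowerSeries ℂ, PowerSeries.coeff 0 (A * φ) = PowerSeries.coeff 0 φ := by
    intro φ
    rw [hAdef, add_mul, sub_mul, one_mul, map_add, map_sub, mul_assoc, PowerSeries.coeff_C_mul, mul_assoc,
      PowerSeries.coeff_C_mul, PowerSeries.coeff_zero_X_mul, PowerSeries.coeff_X_pow_mul', if_neg (by omega), mul_zero,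
      mul_zero, sub_zero, add_zero]
  have hcoeffA1 : ∀ φ : PowerSeries ℂ,
      PowerSeries.coeff 1 (A * φ) = PowerSeries.coeff 1 φ - a * PowerSeries.coeff 0 φ := by
    intro φ
    have hX1 : PowerSeries.coeff 1 (PowerSeries.X * φ) = PowerSeries.coeff 0 φ := PowerSeries.coeff_succ_X_mul 0 φ
    rw [hAdef, add_mul, sub_mul, one_mul, map_add, map_sub, mul_assoc, PowerSeries.coeff_C_mul, mul_assoc,
      PowerSeries.coeff_C_mul, hX1, PowerSeries.coeff_X_pow_mul', if_neg (by omega), mul_zero, add_zero]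
  have hcoeffA2 : ∀ (φ : PowerSeries ℂ) (n : ℕ), PowerSeries.coeff (n + 2) (A * φ) =
      PowerSeries.coeff (n + 2) φ - a * PowerSeries.coeff (n + 1) φ + dlt * PowerSeries.coeff n φ := by
    intro φ n
    rw [hAdef, add_mul, sub_mul, one_mul, map_add, map_sub, mul_assoc, PowerSeries.coeff_C_mul, mul_assoc,
      PowerSeries.coeff_C_mul, show n + 2 = (n + 1) + 1 from rfl, PowerSeries.coeff_succ_X_mul,
      PowerSeries.coeff_X_pow_mul', if_pos (by omega), show n + 1 + 1 - 2 = n by omega]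
  -- `G·B = 1`
  have hGB : G * B = 1 := by
    ext n
    rcases n with _ | n
    · rw [hcoeffB0, hGn, hB, pow_zero, PowerSeries.coeff_zero_eq_constantCoeff, map_one]
    · rw [hcoeffB, hGn, hGn, hB, hB, PowerSeries.coeff_one, if_neg (Nat.succ_ne_zero n), pow_succ]
      ring
  -- `A·H = 1`
  have hAH : A * H = 1 := by
    ext n
    match n with
    | 0 => rw [hcoeffA0, hHn, hH0, PowerSeries.coeff_zero_eq_constantCoeff, map_one]
    | 1 => rw [hcoeffA1, hHn, hHn, hH0, hH1, PowerSeries.coeff_one, if_neg one_ne_zero, mul_one, sub_self]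
    | n + 2 =>
      rw [hcoeffA2, hHn, hHn, hHn, hHrec, PowerSeries.coeff_one, if_neg (by omega)]
      ring
  -- `G = R·H`
  have hGRH : G = R * H := by
    ext n
    rw [hGn, hG, PowerSeries.coeff_mul, Finset.Nat.sum_antidiagonal_eq_sum_range_succ_mk]
    exact Finset.sum_congr rfl fun i _ ↦ by rw [hRn, hHn]
  -- `R·B = A`
  have hRB : R * B = A := by
    calc R * B = R * B * (A * H) := by rw [hAH, mul_one]
      _ = A * ((R * H) * B) := by ring
      _ = A := by rw [← hGRH, hGB, mul_one]
  -- read off the coefficients of `A = A·1`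
  have hA1 : PowerSeries.coeff 1 A = -a := by
    rw [← mul_one A, hcoeffA1, PowerSeries.coeff_one, PowerSeries.coeff_one, if_neg one_ne_zero, if_pos rfl]; ring
  have hA2 : PowerSeries.coeff 2 A = dlt := by
    rw [← mul_one A, hcoeffA2, PowerSeries.coeff_one, PowerSeries.coeff_one, PowerSeries.coeff_one, if_neg (by omega),
      if_neg (by omega), if_pos rfl]; ring
  have hA3 : ∀ n, PowerSeries.coeff (n + 3) A = 0 := by
    intro n
    rw [← mul_one A, show n + 3 = (n + 1) + 2 from rfl, hcoeffA2, PowerSeries.coeff_one, PowerSeries.coeff_one,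
      PowerSeries.coeff_one, if_neg (by omega), if_neg (by omega), if_neg (by omega)]; ring
  refine ⟨?_, ?_, fun n ↦ ?_⟩
  · have h := congrArg (PowerSeries.coeff 1) hRB
    rwa [show (1 : ℕ) = 0 + 1 from rfl, hcoeffB, hRn, hRn, hA1] at h
  · have h := congrArg (PowerSeries.coeff 2) hRB
    rwa [show (2 : ℕ) = 1 + 1 from rfl, hcoeffB, hRn, hRn, hA2] at h
  · have h := congrArg (PowerSeries.coeff (n + 3)) hRB
    rwa [show n + 3 = (n + 2) + 1 from rfl, hcoeffB, hRn, hRn, hA3] at h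

/-! ## §3. The local contradiction -/

/-- Distinct integer powers of a prime (indeed of any natural `ℓ > 1`) are distinct in `ℂ`. [folklore] -/
private theorem natCast_zpow_injective {ℓ : ℕ} (hℓ : 1 < ℓ) {m n : ℤ} (h : (ℓ : ℂ) ^ m = (ℓ : ℂ) ^ n) : m = n := by
  have h' := congrArg norm h
  simp only [norm_zpow, Complex.norm_natCast] at h'
  exact zpow_right_injective₀ (by exact_mod_cast (zero_lt_one.trans hℓ)) (by exact_mod_cast hℓ.ne') h'

/-- Distinct integer powers of a natural `ℓ > 1` are distinct in `ℝ`. [folklore] -/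
private theorem natCast_zpow_injective_real {ℓ : ℕ} (hℓ : 1 < ℓ) {m n : ℤ} (h : (ℓ : ℝ) ^ m = (ℓ : ℝ) ^ n) : m = n :=
  zpow_right_injective₀ (by exact_mod_cast (zero_lt_one.trans hℓ)) (by exact_mod_cast hℓ.ne') h

/-- **The local contradiction.** At a prime `ℓ` with `e = v_ℓ(Q) ≥ 1`: the coefficient identities of `R·(1 − bT) = A`
(`local_coeff_identities`) with `R = Σ_{i ≤ e} r_i T^i`, `r_0 = 1`, `r_e² = ℓ^{ke}` (from the functional equations),
`A = 1 − aT + δT²` with `δ = 𝟙_{ℓ ∤ M} ℓ^{k−1}`, Atkin–Lehner's dichotomy `a = 0 ∨ ‖a‖² = ℓ^{k−2}` when `ℓ ∣ M`, and the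
hypothesis `‖b‖² ≠ ℓ^{k−2}` are INCONSISTENT. [cite: Li1975, Thm. 3 (ii)–(iii) and Thm. 9] -/
private theorem local_contradiction {ℓ : ℕ} (hℓ : ℓ.Prime) {k : ℤ} {e : ℕ} (he : 0 < e) {r : ℕ → ℂ} {a b dlt : ℂ}
    (ellDvdM : Prop) [Decidable ellDvdM]
    (hr0 : r 0 = 1) (hrgt : ∀ j, e < j → r j = 0) (hre : r e ^ 2 = ((ℓ : ℂ) ^ e) ^ k)
    (h1 : r 1 - b * r 0 = -a) (h2 : r 2 - b * r 1 = dlt) (h3 : ∀ n, r (n + 3) - b * r (n + 2) = 0)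
    (hdlt : dlt = if ellDvdM then 0 else (ℓ : ℂ) ^ (k - 1))
    (ha : ellDvdM → a = 0 ∨ ‖a‖ ^ 2 = (ℓ : ℝ) ^ (k - 2)) (hb : ‖b‖ ^ 2 ≠ (ℓ : ℝ) ^ (k - 2)) : False := by
  have hℓ1 : 1 < ℓ := hℓ.one_lt
  have hℓC : (ℓ : ℂ) ≠ 0 := by exact_mod_cast hℓ.ne_zero
  have hℓR : (0 : ℝ) < ℓ := by exact_mod_cast hℓ.pos
  have hre0 : r e ≠ 0 := by
    intro h0
    rw [h0, zero_pow two_ne_zero] at hre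
    exact (zpow_ne_zero k (pow_ne_zero e hℓC)) hre.symm
  -- `‖r e‖² = ℓ^{ke}` over `ℝ`
  have hnorm_re : ‖r e‖ ^ 2 = ((ℓ : ℝ) ^ e) ^ k := by
    have := congrArg norm hre
    rwa [norm_pow, norm_zpow, norm_pow, Complex.norm_natCast] at this
  rcases Nat.lt_or_ge e 3 with hlt | hge
  · -- `e = 1` or `e = 2`
    interval_cases e
    · -- e = 1
      have hr2 : r 2 = 0 := hrgt 2 (by norm_num)
      rw [hr2, zero_sub] at h2
      rw [hr0, mul_one] at h1
      by_cases hM : ellDvdM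
      · -- `ℓ ∣ M`: `δ = 0`, so `b = 0`, `r 1 = -a`
        rw [if_pos hM] at hdlt
        rw [hdlt, neg_eq_zero, mul_eq_zero] at h2
        have hb0 : b = 0 := h2.resolve_right (by simpa using hre0)
        rw [hb0, sub_zero] at h1
        rcases ha hM with ha0 | ha2
        · exact hre0 (by rw [pow_one] at hre; simpa [ha0] using h1)
        · -- `‖a‖² = ℓ^{k-2}` but `‖a‖² = ‖r 1‖² = ℓ^k`
          have h' : ‖a‖ ^ 2 = ((ℓ : ℝ) ^ 1) ^ k := by rw [← hnorm_re, h1, norm_neg]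
          rw [pow_one, ha2] at h'
          have := natCast_zpow_injective_real hℓ1 h'
          omega
      · -- `ℓ ∤ M`: `δ = ℓ^{k-1}`, `-b·r 1 = ℓ^{k-1}`, so `‖b‖²·ℓ^k = ℓ^{2k-2}`
        rw [if_neg hM] at hdlt
        rw [hdlt] at h2
        have hn : ‖b‖ ^ 2 * ‖r 1‖ ^ 2 = ((ℓ : ℝ) ^ (k - 1)) ^ 2 := by
          have := congrArg norm h2
          rw [norm_neg, norm_mul, norm_zpow, Complex.norm_natCast] at this
          rw [← mul_pow, this]
        rw [hnorm_re, pow_one] at hn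
        apply hb
        have hk : (ℓ : ℝ) ^ k ≠ 0 := zpow_ne_zero k hℓR.ne'
        have : ‖b‖ ^ 2 = ((ℓ : ℝ) ^ (k - 1)) ^ 2 / (ℓ : ℝ) ^ k := by rw [← hn, mul_div_cancel_right₀ _ hk]
        rw [this, ← zpow_natCast, ← zpow_mul, div_eq_iff hk, ← zpow_add₀ hℓR.ne']
        congr 1
        push_cast
        ring
    · -- e = 2
      have hr3 : r 3 = 0 := hrgt 3 (by norm_num)
      have h30 := h3 0
      rw [zero_add, hr3, zero_sub, neg_eq_zero, mul_eq_zero] at h30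
      have hb0 : b = 0 := h30.resolve_right hre0
      rw [hb0, zero_mul, sub_zero] at h2
      by_cases hM : ellDvdM
      · rw [if_pos hM] at hdlt
        exact hre0 (h2.trans hdlt)
      · rw [if_neg hM] at hdlt
        rw [h2, hdlt, ← zpow_natCast, ← zpow_mul, ← zpow_natCast (ℓ : ℂ) 2, ← zpow_mul] at hre
        have := natCast_zpow_injective hℓ1 hre
        omega
  · -- `e ≥ 3`
    obtain ⟨m, rfl⟩ : ∃ m, e = m + 3 := ⟨e - 3, by omega⟩
    have hA := h3 (m + 1)
    rw [show m + 1 + 3 = m + 4 from rfl, show m + 1 + 2 = m + 3 from rfl, hrgt (m + 4) (by omega), zero_sub,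
      neg_eq_zero, mul_eq_zero] at hA
    have hb0 : b = 0 := hA.resolve_right hre0
    have hB := h3 m
    rw [hb0, zero_mul, sub_zero] at hB
    exact hre0 hB

/-- **Atkin–Lehner's Thm. 3 at a prime `ℓ ∥ M`, norm form, every weight**: `‖a_ℓ(h)‖² = ℓ^{k−2}` for a newform
`h ∈ S_k(Γ₀(M))` (`a_ℓ = −ℓ^{k/2−1}λ_ℓ`, `λ_ℓ = ±1`; the tree's `IsNewform0.atkinLehnerEigenvalueAt_eq_of_not_dvd` and
`IsNewform0.exists_atkinLehnerInvolutionAt_eq_smul_of_not_dvd`; `zpow` form of the `rpow` statement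
`IsNewform0.norm_cuspCoeff_sq_eq_rpow_of_dvd_of_not_sq_dvd` of `NewformSymmSquareWeightProofs`). [cite: AtkinLehner1970, Thm. 3] -/
theorem IsNewform0.norm_cuspCoeff_sq_eq_zpow_of_dvd_of_not_sq_dvd {M : ℕ} [NeZero M] {k : ℤ}
    {h : CuspForm (Gamma0 M) k} (hh : IsNewform0 h) {ℓ : ℕ} (hℓ : ℓ.Prime) (hℓM : ℓ ∣ M) (hℓ2 : ¬ ℓ ^ 2 ∣ M) :
    ‖cuspCoeff h ℓ‖ ^ 2 = (ℓ : ℝ) ^ (k - 2) := by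
  haveI : Fact ℓ.Prime := ⟨hℓ⟩
  obtain ⟨M', hM'⟩ := hℓM
  have hℓM' : ¬ ℓ ∣ M' := fun ⟨t, ht⟩ ↦ hℓ2 ⟨t, by rw [hM', ht]; ring⟩
  have hf0 : h ≠ 0 := fun h0 ↦ hh.coe_ne_zero (by rw [h0]; rfl)
  obtain ⟨ε, hε1, hε⟩ := hh.exists_atkinLehnerInvolutionAt_eq_smul_of_not_dvd ℓ hM' hℓM'
  have h1 : atkinLehnerEigenvalueAt h ℓ = ε := atkinLehnerEigenvalueAt_eq_of_eq_smul hf0 hε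
  have h2 := hh.atkinLehnerEigenvalueAt_eq_of_not_dvd ℓ hM' hℓM'
  rw [h1] at h2
  have hnorm : ‖ε‖ = 1 := by rcases hε1 with rfl | rfl <;> simp
  have hℓR : (0 : ℝ) < ℓ := by exact_mod_cast hℓ.pos
  have hc : 0 < (ℓ : ℝ) ^ (1 - (k : ℝ) / 2) := Real.rpow_pos_of_pos hℓR _
  have h3 := congrArg norm h2
  rw [hnorm, norm_mul, norm_neg, Complex.norm_real, Real.norm_of_nonneg hc.le] at h3
  change 1 = (ℓ : ℝ) ^ (1 - (k : ℝ) / 2) * ‖cuspCoeff h ℓ‖ at h3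
  have ha : ‖cuspCoeff h ℓ‖ = (ℓ : ℝ) ^ ((k : ℝ) / 2 - 1) := by
    have hinv : (ℓ : ℝ) ^ ((k : ℝ) / 2 - 1) * (ℓ : ℝ) ^ (1 - (k : ℝ) / 2) = 1 := by
      rw [← Real.rpow_add hℓR]; norm_num
    calc ‖cuspCoeff h ℓ‖ = (ℓ : ℝ) ^ ((k : ℝ) / 2 - 1) * ((ℓ : ℝ) ^ (1 - (k : ℝ) / 2) * ‖cuspCoeff h ℓ‖) := by
          rw [← mul_assoc, hinv, one_mul]
      _ = (ℓ : ℝ) ^ ((k : ℝ) / 2 - 1) := by rw [← h3, mul_one]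
  rw [ha, ← Real.rpow_natCast, ← Real.rpow_mul hℓR.le, ← Real.rpow_intCast]
  congr 1
  push_cast
  ring

/-! ## §4. Dividing the functional equations: `c_{Q/d} = C'·c_d·d^{−k}` -/

/-- **The quotient of the two functional equations.** Let `g ∈ S_k(Γ₀(N))`, `h` a newform on `Γ₀(M)`, `N = MQ`, and
`c'` supported on the divisors of `Q` with `a(g) = c' ⋆ a(h)` (so `L(g,s) = P(s)L(h,s)`, `P(s) = Σ_{d∣Q} c'_d d^{−s}`, and
`Λ_N(g,s) = Q^{s/2}P(s)Λ_M(h,s)`).  If `Λ_N(g,·)` has an entire continuation with `Λ(s) = W·Λ(k−s)`, then — dividing by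
Hecke's functional equation `Λ_M(h,s) = i^k ε Λ_M(h,k−s)` of the newform (the entire `Λ_M(h,·)` is not identically zero:
`a₁(h) = 1` and Dirichlet series are injective) — `Q^s P(s) = C'·P(k−s)` identically, i.e. (injectivity of Dirichlet
series again) `c'_{Q/d} = C'·c'_d·d^{−k}` for every `d ∣ Q`. [cite: Li1975, Thm. 9 (proof)] -/
private theorem coeff_relation_of_functionalEquations {N M : ℕ} [NeZero N] [NeZero M] {k : ℤ}
    {g : CuspForm (Gamma0 N) k} {h : CuspForm (Gamma0 M) k} (hh : IsNewform0 h) {Q : ℕ} (hN : N = M * Q)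
    {c' : ℕ → ℂ} (hsupp : ∀ n : ℕ, ¬ n ∣ Q → c' n = 0)
    (hconv : ∀ n : ℕ, n ≠ 0 → cuspCoeff g n = (c' ⍟ cuspCoeff h) n)
    (hFE : ∃ (W : ℂ) (Λ : ℂ → ℂ), Λ ∈ completedCuspFormLContinuations N g ∧ ∀ s : ℂ, Λ s = W * Λ (k - s)) :
    ∃ C' : ℂ, ∀ d ∈ Q.divisors, c' (Q / d) = C' * c' d * (d : ℂ) ^ (-(k : ℂ)) := by
  classical
  have hQ0 : Q ≠ 0 := fun h0 ↦ NeZero.ne N (by rw [hN, h0, mul_zero])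
  have hM0 : M ≠ 0 := NeZero.ne M
  have hQC : (Q : ℂ) ≠ 0 := by exact_mod_cast hQ0
  -- `P(s) = L(c', s)` is a Dirichlet polynomial
  have hterm : ∀ (s : ℂ) (n : ℕ), n ∉ Q.divisors → LSeries.term c' s n = 0 := by
    intro s n hn
    rcases eq_or_ne n 0 with rfl | hn0
    · exact LSeries.term_zero _ _
    rw [LSeries.term_of_ne_zero hn0, hsupp n (fun hd ↦ hn (Nat.mem_divisors.mpr ⟨hd, hQ0⟩)), zero_div]
  have hPsum : ∀ s : ℂ, LSeriesSummable c' s := fun s ↦ summable_of_ne_finset_zero (hterm s)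
  have hPfin : ∀ s : ℂ, LSeries c' s = ∑ d ∈ Q.divisors, c' d * (d : ℂ) ^ (-s) := by
    intro s
    rw [LSeries, tsum_eq_sum (hterm s)]
    refine Finset.sum_congr rfl fun d hd ↦ ?_
    rw [LSeries.term_of_ne_zero (Nat.pos_of_mem_divisors hd).ne', div_eq_mul_inv, ← Complex.cpow_neg]
  have hPdiff : Differentiable ℂ (LSeries c') := by
    rw [show LSeries c' = fun s ↦ ∑ d ∈ Q.divisors, c' d * (d : ℂ) ^ (-s) from funext hPfin]
    refine Differentiable.fun_sum fun d hd ↦ ?_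
    have hd0 : (d : ℂ) ≠ 0 := by exact_mod_cast (Nat.pos_of_mem_divisors hd).ne'
    exact fun s ↦ ((differentiableAt_id.neg.const_cpow (Or.inl hd0)).const_mul _)
  -- `L(g,s) = P(s)·L(h,s)` on the half-plane of absolute convergence
  have hLg : ∀ s : ℂ, (k : ℝ) / 2 + 1 < s.re →
      LSeries (cuspCoeff g) s = LSeries c' s * LSeries (cuspCoeff h) s := by
    intro s hs
    rw [LSeries_congr (f := cuspCoeff g) (g := c' ⍟ cuspCoeff h) (fun hn ↦ hconv _ hn) s]
    exact LSeries_convolution' (hPsum s) (LSeriesSummable_cuspCoeff_gamma0 h hs)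
  -- the two entire continuations
  obtain ⟨W, Λg, ⟨hΛg_diff, hΛg_eq⟩, hFEg⟩ := hFE
  obtain ⟨Λh, ⟨hΛh_diff, hΛh_eq⟩, hFEh⟩ := IsNewform0.exists_functional_equation_holds hh
  -- `Λ_N(g,s) = Q^{s/2} P(s) Λ_M(h,s)`
  set E : ℂ → ℂ := fun s ↦ (Q : ℂ) ^ (s / 2) * LSeries c' s * Λh s with hEdef
  have hQpow_diff : Differentiable ℂ (fun s : ℂ ↦ (Q : ℂ) ^ (s / 2)) :=
    fun s ↦ (differentiableAt_id.div_const 2).const_cpow (Or.inl hQC)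
  have hE_diff : Differentiable ℂ E := (hQpow_diff.mul hPdiff).mul hΛh_diff
  have hE_eq : ∀ s : ℂ, (k : ℝ) / 2 + 1 < s.re → E s = completedCuspFormL N g s := by
    intro s hs
    simp only [hEdef, completedCuspFormL, cuspFormLSeries]
    rw [hΛh_eq s hs, hLg s hs]
    simp only [completedCuspFormL, cuspFormLSeries]
    rw [hN, Nat.cast_mul, Complex.natCast_mul_natCast_cpow]
    ring
  have hΛgE : Λg = E :=
    subsingleton_completedCuspFormLContinuations N g ⟨hΛg_diff, hΛg_eq⟩ ⟨hE_diff, hE_eq⟩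
  -- `Λ_M(h,·)` is not identically zero
  have hΛh_ne : ∃ s₀, Λh s₀ ≠ 0 := by
    by_contra hall
    have hall' : ∀ s, Λh s = 0 := fun s ↦ not_not.mp (not_exists.mp hall s)
    have hzero : (fun x : ℝ ↦ LSeries (cuspCoeff h) x) =ᶠ[Filter.atTop] 0 := by
      filter_upwards [Filter.eventually_gt_atTop ((k : ℝ) / 2 + 1), Filter.eventually_gt_atTop (0 : ℝ)]
        with x hx hx0
      have hx' : (k : ℝ) / 2 + 1 < (x : ℂ).re := by rwa [Complex.ofReal_re]
      have h0 := hΛh_eq x hx'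
      rw [hall'] at h0
      simp only [completedCuspFormL, cuspFormLSeries] at h0
      have h1 : (M : ℂ) ^ ((x : ℂ) / 2) ≠ 0 := by
        rw [Ne, Complex.cpow_eq_zero_iff, not_and_or]
        exact Or.inl (by exact_mod_cast hM0)
      have h2 : (2 * Real.pi : ℂ) ^ (-(x : ℂ)) ≠ 0 := by
        rw [Ne, Complex.cpow_eq_zero_iff, not_and_or]
        exact Or.inl (by exact_mod_cast (by positivity : (2 * Real.pi : ℝ) ≠ 0))
      have h3 : Complex.Gamma (x : ℂ) ≠ 0 := Complex.Gamma_ne_zero_of_re_pos (by rwa [Complex.ofReal_re])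
      simp only [Pi.zero_apply]
      have := h0.symm
      rw [mul_eq_zero, mul_eq_zero, mul_eq_zero] at this
      rcases this with ((h | h) | h) | h
      · exact absurd h h1
      · exact absurd h h2
      · exact absurd h h3
      · exact h
    rcases LSeries_eventually_eq_zero_iff'.mp hzero with hcoef | htop
    · exact one_ne_zero ((hh.2.2).symm.trans (hcoef 1 one_ne_zero))
    · have hsum := LSeriesSummable_cuspCoeff_gamma0 h (s := (((k : ℝ) / 2 + 2 : ℝ) : ℂ))
        (by rw [Complex.ofReal_re]; linarith)
      have hle := hsum.abscissaOfAbsConv_le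
      rw [htop, top_le_iff] at hle
      exact EReal.coe_ne_top _ hle
  obtain ⟨s₀, hs₀⟩ := hΛh_ne
  -- `F(s) = Q^{s/2}P(s) − C·Q^{(k−s)/2}P(k−s)` vanishes identically
  set C : ℂ := W * Complex.I ^ k * frickeEigenvalue h with hCdef
  set F : ℂ → ℂ := fun s ↦ (Q : ℂ) ^ (s / 2) * LSeries c' s -
    C * ((Q : ℂ) ^ (((k : ℂ) - s) / 2) * LSeries c' ((k : ℂ) - s)) with hFdef
  have hcomp : Differentiable ℂ (fun s : ℂ ↦ (k : ℂ) - s) := (differentiable_const _).sub differentiable_id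
  have hF_diff : Differentiable ℂ F :=
    (hQpow_diff.mul hPdiff).sub (((hQpow_diff.comp hcomp).mul (hPdiff.comp hcomp)).const_mul C)
  have hFΛ : ∀ s, F s * Λh s = 0 := by
    intro s
    have h1 : Λg s = W * Λg ((k : ℂ) - s) := hFEg s
    have h2 : Λh ((k : ℂ) - s) = Complex.I ^ k * frickeEigenvalue h * Λh s := by
      have := hFEh ((k : ℂ) - s)
      rwa [sub_sub_cancel] at this
    rw [hΛgE] at h1
    simp only [hEdef] at h1
    rw [h2] at h1
    simp only [hFdef, hCdef]
    linear_combination h1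
  have hF0 : ∀ s, F s = 0 := by
    have hev : F =ᶠ[nhds s₀] 0 := by
      have hne : ∀ᶠ s in nhds s₀, Λh s ≠ 0 := hΛh_diff.continuous.continuousAt.eventually_ne hs₀
      filter_upwards [hne] with s hs
      exact (mul_eq_zero.mp (hFΛ s)).resolve_right hs
    have hEqOn := (hF_diff.differentiableOn.analyticOnNhd isOpen_univ).eqOn_zero_of_preconnected_of_eventuallyEq_zero
      isPreconnected_univ (Set.mem_univ s₀) hev
    exact fun s ↦ hEqOn (Set.mem_univ s)
  -- `Q^s P(s) = C'·P(k−s)`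
  set C' : ℂ := C * (Q : ℂ) ^ ((k : ℂ) / 2) with hC'def
  have hQs : ∀ s : ℂ, (Q : ℂ) ^ s * LSeries c' s = C' * LSeries c' ((k : ℂ) - s) := by
    intro s
    have h0 : (Q : ℂ) ^ (s / 2) * LSeries c' s = C * ((Q : ℂ) ^ (((k : ℂ) - s) / 2) * LSeries c' ((k : ℂ) - s)) :=
      sub_eq_zero.mp (hF0 s)
    have hsplit : (Q : ℂ) ^ s = (Q : ℂ) ^ (s / 2) * (Q : ℂ) ^ (s / 2) := by
      rw [← Complex.cpow_add _ _ hQC]; ring_nf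
    have hsplit' : (Q : ℂ) ^ (s / 2) * (Q : ℂ) ^ (((k : ℂ) - s) / 2) = (Q : ℂ) ^ ((k : ℂ) / 2) := by
      rw [← Complex.cpow_add _ _ hQC]; ring_nf
    calc (Q : ℂ) ^ s * LSeries c' s = (Q : ℂ) ^ (s / 2) * ((Q : ℂ) ^ (s / 2) * LSeries c' s) := by
          rw [hsplit, mul_assoc]
      _ = (Q : ℂ) ^ (s / 2) * (C * ((Q : ℂ) ^ (((k : ℂ) - s) / 2) * LSeries c' ((k : ℂ) - s))) := by rw [h0]
      _ = C' * LSeries c' ((k : ℂ) - s) := by rw [hC'def, ← hsplit']; ring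
  -- the Dirichlet polynomial `Σ_{d∣Q} (c'_{Q/d} − C' c'_d d^{−k}) d^{s}` vanishes identically
  set α : ℕ → ℂ := fun d ↦ if d ∈ Q.divisors then c' (Q / d) - C' * c' d * (d : ℂ) ^ (-(k : ℂ)) else 0 with hαdef
  have hαsum : ∀ s : ℂ, ∑ d ∈ Q.divisors, α d * (d : ℂ) ^ s = 0 := by
    intro s
    have hL := hQs s
    rw [hPfin s, hPfin ((k : ℂ) - s), Finset.mul_sum, Finset.mul_sum] at hL
    have hlhs : ∑ d ∈ Q.divisors, (Q : ℂ) ^ s * (c' d * (d : ℂ) ^ (-s)) =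
        ∑ d ∈ Q.divisors, c' (Q / d) * (d : ℂ) ^ s := by
      rw [← Nat.sum_div_divisors Q (fun d ↦ c' (Q / d) * (d : ℂ) ^ s)]
      refine Finset.sum_congr rfl fun d hd ↦ ?_
      obtain ⟨hdQ, -⟩ := Nat.mem_divisors.mp hd
      have hd0 : (d : ℂ) ≠ 0 := by exact_mod_cast (Nat.pos_of_mem_divisors hd).ne'
      have hds : (d : ℂ) ^ s ≠ 0 := by
        rw [Ne, Complex.cpow_eq_zero_iff, not_and_or]; exact Or.inl hd0
      rw [Nat.div_div_self hdQ hQ0]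
      have hQd : (Q : ℂ) = (d : ℂ) * ((Q / d : ℕ) : ℂ) := by rw [← Nat.cast_mul, Nat.mul_div_cancel' hdQ]
      rw [hQd, Complex.natCast_mul_natCast_cpow, Complex.cpow_neg]
      field_simp
    have hrhs : ∑ d ∈ Q.divisors, C' * (c' d * (d : ℂ) ^ (-((k : ℂ) - s))) =
        ∑ d ∈ Q.divisors, C' * c' d * (d : ℂ) ^ (-(k : ℂ)) * (d : ℂ) ^ s := by
      refine Finset.sum_congr rfl fun d hd ↦ ?_
      have hd0 : (d : ℂ) ≠ 0 := by exact_mod_cast (Nat.pos_of_mem_divisors hd).ne'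
      rw [show -((k : ℂ) - s) = -(k : ℂ) + s by ring, Complex.cpow_add _ _ hd0]
      ring
    rw [hlhs, hrhs, ← sub_eq_zero, ← Finset.sum_sub_distrib] at hL
    rw [← hL]
    refine Finset.sum_congr rfl fun d hd ↦ ?_
    rw [hαdef]
    simp only [if_pos hd]
    ring
  -- hence `α = 0` (injectivity of Dirichlet series)
  have hα0 : α 0 = 0 := by
    rw [hαdef]
    simp only [Nat.mem_divisors, zero_dvd_iff, hQ0, false_and, if_false]
  have hαterm : ∀ (s : ℂ) (n : ℕ), n ∉ Q.divisors → LSeries.term α s n = 0 := by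
    intro s n hn
    rcases eq_or_ne n 0 with rfl | hn0
    · exact LSeries.term_zero _ _
    rw [LSeries.term_of_ne_zero hn0, hαdef]
    simp only [hn, if_false, zero_div]
  have hLα : LSeries α = 0 := by
    funext s
    rw [LSeries, tsum_eq_sum (hαterm s), Pi.zero_apply, ← hαsum (-s)]
    refine Finset.sum_congr rfl fun d hd ↦ ?_
    rw [LSeries.term_of_ne_zero (Nat.pos_of_mem_divisors hd).ne', div_eq_mul_inv, ← Complex.cpow_neg]
  have hαabs : LSeries.abscissaOfAbsConv α ≠ ⊤ := by
    have hs : LSeriesSummable α 0 := summable_of_ne_finset_zero (hαterm 0)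
    have hle := hs.abscissaOfAbsConv_le
    intro htop
    rw [htop, top_le_iff, Complex.zero_re] at hle
    exact EReal.coe_ne_top _ hle
  have hαzero : α = 0 := ((LSeries_eq_zero_iff hα0).mp hLα).resolve_right hαabs
  refine ⟨C', fun d hd ↦ ?_⟩
  have := congrFun hαzero d
  rw [hαdef] at this
  simp only [if_pos hd, Pi.zero_apply, sub_eq_zero] at this
  exact this

/-! ## §5. The theorems -/

/-- **Multiplicity one at equal level, packet form**: a normalised form `g ∈ S_k(Γ₀(N))` with the `T_p`-packet (`p ∤ N`)
of a newform `h` of the SAME level is `h` (`g ∈ ℂ·h` by the Atkin–Lehner span with `N/M = 1`, and `a₁ = 1`).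
[cite: AtkinLehner1970, Thm. 4] -/
theorem eq_newform_of_eigenpacket {N : ℕ} [NeZero N] {k : ℤ} {g h : CuspForm (Gamma0 N) k} (hh : IsNewform0 h)
    (hT : ∀ (p : ℕ) (hp : p.Prime), ¬ p ∣ N → (haveI : NeZero p := ⟨hp.ne_zero⟩; heckeT (Gamma0 N) k p g) = cuspCoeff h p • g)
    (h1 : cuspCoeff g 1 = 1) : g = h := by
  classical
  obtain ⟨c, hc⟩ := exists_cuspCoeff_eq_sum_of_eigenpacket (dvd_refl N) hh hT
  have hdiv : (N / N).divisors = {1} := by rw [Nat.div_self (NeZero.pos N), Nat.divisors_one]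
  simp only [hdiv, Finset.sum_singleton, one_dvd, if_true, Nat.div_one] at hc
  have hh1 : cuspCoeff h 1 = 1 := hh.2.2
  have hc1 : c 1 = 1 := by have := hc 1; rwa [h1, hh1, mul_one, eq_comm] at this
  exact eq_of_forall_cuspCoeff_eq_gamma0 fun n ↦ by rw [hc n, hc1, one_mul]

/-- ★ **The level of an eigenform satisfying Hecke's functional equation at level `N` is the level of its newform**
(Li 1975, Thm. 9 with Thm. 3; Miyake Thm. 4.6.17; Atkin–Lehner 1970, Thms. 3–5).  Let `g ∈ S_k(Γ₀(N))` be normalised,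
with the `T_p`-packet (`p ∤ N`) of a newform `h ∈ S_k(Γ₀(M))`, `M ∣ N`, with multiplicative Fourier coefficients that are
geometric at the level primes (`a_{ℓ^j}(g) = a_ℓ(g)^j`) with `‖a_ℓ(g)‖² ≠ ℓ^{k−2}` there, and such that
`Λ_N(g,s) = N^{s/2}(2π)^{−s}Γ(s)L(g,s)` has an ENTIRE continuation `Λ` with `Λ(s) = W·Λ(k−s)`.  Then `N = M`.
See the module docstring for the proof. [cite: Li1975, Thm. 3 and Thm. 9] [cite: AtkinLehner1970, Thms. 3–5] -/
theorem level_eq_of_functionalEquation {N M : ℕ} [NeZero N] [NeZero M] {k : ℤ}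
    {g : CuspForm (Gamma0 N) k} {h : CuspForm (Gamma0 M) k} (hh : IsNewform0 h) (hMN : M ∣ N)
    (hT : ∀ (p : ℕ) (hp : p.Prime), ¬ p ∣ N → (haveI : NeZero p := ⟨hp.ne_zero⟩; heckeT (Gamma0 N) k p g) = cuspCoeff h p • g)
    (h1 : cuspCoeff g 1 = 1)
    (hmul : ∀ m n : ℕ, m.Coprime n → cuspCoeff g (m * n) = cuspCoeff g m * cuspCoeff g n)
    (hpow : ∀ ℓ : ℕ, ℓ.Prime → ℓ ∣ N → ∀ j : ℕ, cuspCoeff g (ℓ ^ j) = cuspCoeff g ℓ ^ j)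
    (hnorm : ∀ ℓ : ℕ, ℓ.Prime → ℓ ∣ N → ‖cuspCoeff g ℓ‖ ^ 2 ≠ (ℓ : ℝ) ^ (k - 2))
    (hFE : ∃ (W : ℂ) (Λ : ℂ → ℂ), Λ ∈ completedCuspFormLContinuations N g ∧ ∀ s : ℂ, Λ s = W * Λ (k - s)) :
    N = M := by
  classical
  set Q : ℕ := N / M with hQdef
  have hN : N = M * Q := (Nat.mul_div_cancel' hMN).symm
  have hQ0 : Q ≠ 0 := fun h0 ↦ NeZero.ne N (by rw [hN, h0, mul_zero])
  have hh1 : cuspCoeff h 1 = 1 := hh.2.2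
  -- Step 1: the Atkin–Lehner span, coefficient form
  obtain ⟨c, hc⟩ := exists_cuspCoeff_eq_sum_of_eigenpacket hMN hh hT
  set c₀ : ℕ → ℂ := fun d ↦ if d ∈ Q.divisors then c d else 0 with hc₀def
  have hc1 : c 1 = 1 := by
    have h := hc 1
    rw [h1, Finset.sum_eq_single 1] at h
    · simpa [hh1] using h.symm
    · intro d _ hd1
      rw [if_neg (fun h1d ↦ hd1 (Nat.dvd_one.mp h1d)), mul_zero]
    · intro h1'
      exact absurd (Nat.one_mem_divisors.mpr hQ0) h1'
  have hc₀1 : c₀ 1 = 1 := by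
    rw [hc₀def]
    simp only [Nat.one_mem_divisors.mpr hQ0, if_true, hc1]
  -- the prime-power coefficients of `g`
  have hkey : ∀ (p e : ℕ), p.Prime → ∀ F : ℕ → ℂ,
      ∑ d ∈ Q.divisors, (if d ∣ p ^ e then F d else 0) = ∑ i ∈ range (e + 1), (if p ^ i ∣ Q then F (p ^ i) else 0) := by
    intro p e hp F
    have hpe : p ^ e ≠ 0 := pow_ne_zero _ hp.ne_zero
    calc ∑ d ∈ Q.divisors, (if d ∣ p ^ e then F d else 0)
        = ∑ d ∈ Q.divisors with d ∣ p ^ e, F d := (Finset.sum_filter _ _).symm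
      _ = ∑ d ∈ (p ^ e).divisors with d ∣ Q, F d := by
          refine Finset.sum_congr ?_ fun _ _ ↦ rfl
          ext d
          simp only [Finset.mem_filter, Nat.mem_divisors]
          constructor
          · rintro ⟨⟨hdQ, -⟩, hdp⟩; exact ⟨⟨hdp, hpe⟩, hdQ⟩
          · rintro ⟨⟨hdp, -⟩, hdQ⟩; exact ⟨⟨hdQ, hQ0⟩, hdp⟩
      _ = ∑ d ∈ (p ^ e).divisors, (if d ∣ Q then F d else 0) := Finset.sum_filter _ _
      _ = ∑ i ∈ range (e + 1), (if p ^ i ∣ Q then F (p ^ i) else 0) := by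
          rw [Nat.divisors_prime_pow hp, Finset.sum_map]
          rfl
  have hpp : ∀ p e : ℕ, p.Prime →
      cuspCoeff g (p ^ e) = ∑ i ∈ range (e + 1), c₀ (p ^ i) * cuspCoeff h (p ^ (e - i)) := by
    intro p e hp
    rw [hc (p ^ e)]
    have hstep : ∑ d ∈ Q.divisors, c d * (if d ∣ p ^ e then cuspCoeff h (p ^ e / d) else 0) =
        ∑ d ∈ Q.divisors, (if d ∣ p ^ e then c d * cuspCoeff h (p ^ e / d) else 0) :=
      Finset.sum_congr rfl fun d _ ↦ by split_ifs <;> simp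
    rw [hstep, hkey p e hp]
    refine Finset.sum_congr rfl fun i hi ↦ ?_
    have hi' : i ≤ e := Nat.lt_succ_iff.mp (mem_range.mp hi)
    rw [Nat.pow_div hi' hp.pos, hc₀def]
    simp only [Nat.mem_divisors, hQ0, ne_eq, not_false_eq_true, and_true]
    split_ifs <;> simp
  -- Step 2: multiplicativity; `a(g) = c' ⋆ a(h)` with `c'` multiplicative, supported on the divisors of `Q`
  have ha : ArithmeticFunction.IsMultiplicative (toArithmeticFunction (cuspCoeff g)) := by
    refine ⟨by simp [toArithmeticFunction, h1], fun {m n} hmn ↦ ?_⟩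
    rcases eq_or_ne m 0 with rfl | hm
    · simp [toArithmeticFunction]
    rcases eq_or_ne n 0 with rfl | hn
    · simp [toArithmeticFunction]
    simp only [toArithmeticFunction, ArithmeticFunction.coe_mk, hm, hn, mul_ne_zero hm hn, if_false]
    exact hmul m n hmn
  have hb : ArithmeticFunction.IsMultiplicative (toArithmeticFunction (cuspCoeff h)) := by
    refine ⟨by simp [toArithmeticFunction, hh1], fun {m n} hmn ↦ ?_⟩
    rcases eq_or_ne m 0 with rfl | hm
    · simp [toArithmeticFunction]
    rcases eq_or_ne n 0 with rfl | hn
    · simp [toArithmeticFunction]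
    simp only [toArithmeticFunction, ArithmeticFunction.coe_mk, hm, hn, mul_ne_zero hm hn, if_false]
    exact IsNewform0.coeff_mul_of_coprime_holds hh hmn
  obtain ⟨c', hc'm, hc'0, hc'p, hconv⟩ := exists_isMultiplicative_convolution_eq ha hb hc₀1 hpp
  have hsuppQ : ∀ n : ℕ, ¬ n ∣ Q → c' n = 0 := by
    intro n hn
    rcases eq_or_ne n 0 with rfl | hn0
    · exact hc'0
    by_contra hne
    refine hn (dvd_of_isMultiplicative_ne_zero hc'm hQ0 (fun p e hp _ hpe ↦ ?_) hn0 hne)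
    rw [hc'p p e hp, hc₀def]
    simp only [Nat.mem_divisors, hpe, false_and, if_false]
  have hc'1 : c' 1 = 1 := by
    have := hc'p 2 0 Nat.prime_two
    rw [pow_zero] at this
    rw [this, hc₀1]
  -- Step 3: the functional equations give `c'_{Q/d} = C' c'_d d^{−k}`
  obtain ⟨C', hrel⟩ := coeff_relation_of_functionalEquations hh hN hsuppQ hconv hFE
  have hCQ : c' Q = C' := by
    have := hrel 1 (Nat.one_mem_divisors.mpr hQ0)
    rwa [Nat.div_one, hc'1, mul_one, Nat.cast_one, Complex.one_cpow, mul_one] at this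
  -- Step 4: every prime exponent of `Q` vanishes
  have hfac : ∀ ℓ : ℕ, ℓ.Prime → Q.factorization ℓ = 0 := by
    intro ℓ hℓ
    by_contra hne
    have he : 0 < Q.factorization ℓ := Nat.pos_of_ne_zero hne
    set e : ℕ := Q.factorization ℓ with hedef
    have hℓC : (ℓ : ℂ) ≠ 0 := by exact_mod_cast hℓ.ne_zero
    have hℓe : ℓ ^ e ∣ Q := Nat.ordProj_dvd Q ℓ
    have hcop : Nat.Coprime (ℓ ^ e) (Q / ℓ ^ e) := (Nat.coprime_ordCompl hℓ hQ0).pow_left e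
    have hQsplit : ℓ ^ e * (Q / ℓ ^ e) = Q := Nat.ordProj_mul_ordCompl_eq_self Q ℓ
    have hmulQ : c' Q = c' (ℓ ^ e) * c' (Q / ℓ ^ e) := by
      have hm := hc'm.map_mul_of_coprime hcop
      rw [hQsplit] at hm
      have h1' : ℓ ^ e ≠ 0 := pow_ne_zero _ hℓ.ne_zero
      have h2' : Q / ℓ ^ e ≠ 0 := (Nat.ordCompl_pos ℓ hQ0).ne'
      simpa only [toArithmeticFunction, ArithmeticFunction.coe_mk, hQ0, h1', h2', if_false] using hm
    have hrel_e := hrel (ℓ ^ e) (Nat.mem_divisors.mpr ⟨hℓe, hQ0⟩)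
    -- `c'(ℓ^e)² = ℓ^{ke}`
    have hre : c' (ℓ ^ e) ^ 2 = ((ℓ : ℂ) ^ e) ^ k := by
      have hX : ((ℓ ^ e : ℕ) : ℂ) ^ (-(k : ℂ)) = (((ℓ : ℂ) ^ e) ^ k)⁻¹ := by
        rw [Complex.cpow_neg, Complex.cpow_intCast, Nat.cast_pow]
      have hpowk : ((ℓ : ℂ) ^ e) ^ k ≠ 0 := zpow_ne_zero k (pow_ne_zero e hℓC)
      have hC'0 : C' ≠ 0 := by
        intro h0
        have := hrel Q (Nat.mem_divisors_self Q hQ0)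
        rw [Nat.div_self (Nat.pos_of_ne_zero hQ0), hc'1, hCQ, h0, zero_mul, zero_mul] at this
        exact one_ne_zero this
      have h := hCQ
      rw [hmulQ, hrel_e, hX] at h
      -- `c'(ℓ^e) * (C' * c'(ℓ^e) * ((ℓ^e)^k)⁻¹) = C'`
      field_simp at h
      linear_combination h
    -- the local identities and the contradiction
    have hℓQ : ℓ ∣ Q := (dvd_pow_self ℓ he.ne').trans hℓe
    have hℓN : ℓ ∣ N := hℓQ.trans ⟨M, by rw [hN, mul_comm]⟩
    obtain ⟨hI, hII, hIII⟩ := local_coeff_identities (r := fun i ↦ c' (ℓ ^ i))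
      (aG := fun n ↦ cuspCoeff g (ℓ ^ n)) (aH := fun n ↦ cuspCoeff h (ℓ ^ n))
      (a := cuspCoeff h ℓ) (b := cuspCoeff g ℓ) (dlt := if ℓ ∣ M then 0 else (ℓ : ℂ) ^ (k - 1))
      (fun n ↦ by
        rw [hconv _ (pow_ne_zero n hℓ.ne_zero), LSeries.convolution_def]
        exact sum_divisorsAntidiagonal_prime_pow hℓ n (fun x ↦ c' x.1 * cuspCoeff h x.2))
      (fun n ↦ hpow ℓ hℓ hℓN n) (by simp [hh1]) (by simp)
      (fun n ↦ hh.cuspCoeff_prime_pow_add_two_weight hℓ n)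
    refine local_contradiction hℓ he (ℓ ∣ M) (by simp [hc'1]) (fun j hj ↦ hsuppQ _ fun hdvd ↦ ?_) hre hI hII hIII rfl
      (fun hℓM ↦ ?_) (hnorm ℓ hℓ hℓN)
    · have := (hℓ.pow_dvd_iff_le_factorization hQ0).mp hdvd
      omega
    · by_cases h2 : ℓ ^ 2 ∣ M
      · exact Or.inl (hh.cuspCoeff_eq_zero_of_sq_dvd hℓ h2)
      · exact Or.inr (hh.norm_cuspCoeff_sq_eq_zpow_of_dvd_of_not_sq_dvd hℓ hℓM h2)
  -- Step 5: `Q = 1`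
  have hQ1 : Q = 1 := by
    have hzero : Q.factorization = 0 := Finsupp.ext fun ℓ ↦ by
      by_cases hℓ : ℓ.Prime
      · exact hfac ℓ hℓ
      · exact Nat.factorization_eq_zero_of_not_prime Q hℓ
    rcases (Nat.factorization_eq_zero_iff' Q).mp hzero with h0 | h0
    · exact absurd h0 hQ0
    · exact h0
  rw [hN, hQ1, mul_one]

/-- ★★ **Li's criterion: an eigenform on `Γ₀(N)` satisfying the self-dual functional equation of level `N` is a newform**
(Li 1975, Thm. 9; Miyake Thm. 4.6.17; Atkin–Lehner 1970): under the hypotheses of `level_eq_of_functionalEquation`,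
`g` IS the newform `h` (transported along `N = M`), in particular `IsNewform0 g`.  The hypotheses `a_{ℓ^j}(g) = a_ℓ(g)^j`,
`‖a_ℓ(g)‖² ≠ ℓ^{k−2}` at `ℓ ∣ N` replace the Ramanujan bound of the printed proofs (they exclude the Steinberg-type old
`U_ℓ`-eigenvalue `±ℓ^{k/2−1}`); theta series of Größencharaktere satisfy them with `‖a_ℓ‖² ∈ {0, ℓ^{k−1}}`.
[cite: Li1975, Thm. 9] [cite: Miyake2006, Thm. 4.6.17] -/
theorem isNewform0_of_functionalEquation {N M : ℕ} [NeZero N] [NeZero M] {k : ℤ}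
    {g : CuspForm (Gamma0 N) k} {h : CuspForm (Gamma0 M) k} (hh : IsNewform0 h) (hMN : M ∣ N)
    (hT : ∀ (p : ℕ) (hp : p.Prime), ¬ p ∣ N → (haveI : NeZero p := ⟨hp.ne_zero⟩; heckeT (Gamma0 N) k p g) = cuspCoeff h p • g)
    (h1 : cuspCoeff g 1 = 1)
    (hmul : ∀ m n : ℕ, m.Coprime n → cuspCoeff g (m * n) = cuspCoeff g m * cuspCoeff g n)
    (hpow : ∀ ℓ : ℕ, ℓ.Prime → ℓ ∣ N → ∀ j : ℕ, cuspCoeff g (ℓ ^ j) = cuspCoeff g ℓ ^ j)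
    (hnorm : ∀ ℓ : ℕ, ℓ.Prime → ℓ ∣ N → ‖cuspCoeff g ℓ‖ ^ 2 ≠ (ℓ : ℝ) ^ (k - 2))
    (hFE : ∃ (W : ℂ) (Λ : ℂ → ℂ), Λ ∈ completedCuspFormLContinuations N g ∧ ∀ s : ℂ, Λ s = W * Λ (k - s)) :
    IsNewform0 g := by
  obtain rfl : N = M := level_eq_of_functionalEquation hh hMN hT h1 hmul hpow hnorm hFE
  rw [eq_newform_of_eigenpacket hh hT h1]
  exact hh

/-! ## §6. The functional equation against the CONJUGATE form `g^ρ = Σ ā_n qⁿ` (Hecke's `Λ(χ,s) = W·Λ(χ̄, k−s)`) -/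

/-- **The local contradiction, norm form** (`‖r_e‖² = ℓ^{ke}`, which is what the functional equation against the CONJUGATE form
gives): the coefficient identities of `R·(1 − bT) = A` (`local_coeff_identities`) with `R = Σ_{i ≤ e} r_i T^i`, `r_0 = 1`,
`‖r_e‖² = ℓ^{ke}`, `A = 1 − aT + δT²` with `δ = 𝟙_{ℓ ∤ M} ℓ^{k−1}`, Atkin–Lehner's dichotomy `a = 0 ∨ ‖a‖² = ℓ^{k−2}` when `ℓ ∣ M`,
and the hypothesis `‖b‖² ≠ ℓ^{k−2}` are INCONSISTENT. [cite: Li1975, Thm. 3 (ii)–(iii) and Thm. 9] -/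
private theorem local_contradiction_of_norm {ℓ : ℕ} (hℓ : ℓ.Prime) {k : ℤ} {e : ℕ} (he : 0 < e) {r : ℕ → ℂ} {a b dlt : ℂ}
    (ellDvdM : Prop) [Decidable ellDvdM]
    (hr0 : r 0 = 1) (hrgt : ∀ j, e < j → r j = 0) (hnorm_re : ‖r e‖ ^ 2 = ((ℓ : ℝ) ^ e) ^ k)
    (h1 : r 1 - b * r 0 = -a) (h2 : r 2 - b * r 1 = dlt) (h3 : ∀ n, r (n + 3) - b * r (n + 2) = 0)
    (hdlt : dlt = if ellDvdM then 0 else (ℓ : ℂ) ^ (k - 1))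
    (ha : ellDvdM → a = 0 ∨ ‖a‖ ^ 2 = (ℓ : ℝ) ^ (k - 2)) (hb : ‖b‖ ^ 2 ≠ (ℓ : ℝ) ^ (k - 2)) : False := by
  have hℓ1 : 1 < ℓ := hℓ.one_lt
  have hℓC : (ℓ : ℂ) ≠ 0 := by exact_mod_cast hℓ.ne_zero
  have hℓR : (0 : ℝ) < ℓ := by exact_mod_cast hℓ.pos
  have hre0 : r e ≠ 0 := by
    intro h0
    rw [h0, norm_zero, zero_pow two_ne_zero] at hnorm_re
    exact (zpow_ne_zero k (pow_ne_zero e hℓR.ne')) hnorm_re.symm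
  rcases Nat.lt_or_ge e 3 with hlt | hge
  · -- `e = 1` or `e = 2`
    interval_cases e
    · -- e = 1
      have hr2 : r 2 = 0 := hrgt 2 (by norm_num)
      rw [hr2, zero_sub] at h2
      rw [hr0, mul_one] at h1
      by_cases hM : ellDvdM
      · -- `ℓ ∣ M`: `δ = 0`, so `b = 0`, `r 1 = -a`
        rw [if_pos hM] at hdlt
        rw [hdlt, neg_eq_zero, mul_eq_zero] at h2
        have hb0 : b = 0 := h2.resolve_right (by simpa using hre0)
        rw [hb0, sub_zero] at h1
        rcases ha hM with ha0 | ha2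
        · exact hre0 (by simpa [ha0] using h1)
        · -- `‖a‖² = ℓ^{k-2}` but `‖a‖² = ‖r 1‖² = ℓ^k`
          have h' : ‖a‖ ^ 2 = ((ℓ : ℝ) ^ 1) ^ k := by rw [← hnorm_re, h1, norm_neg]
          rw [pow_one, ha2] at h'
          have := natCast_zpow_injective_real hℓ1 h'
          omega
      · -- `ℓ ∤ M`: `δ = ℓ^{k-1}`, `-b·r 1 = ℓ^{k-1}`, so `‖b‖²·ℓ^k = ℓ^{2k-2}`
        rw [if_neg hM] at hdlt
        rw [hdlt] at h2
        have hn : ‖b‖ ^ 2 * ‖r 1‖ ^ 2 = ((ℓ : ℝ) ^ (k - 1)) ^ 2 := by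
          have := congrArg norm h2
          rw [norm_neg, norm_mul, norm_zpow, Complex.norm_natCast] at this
          rw [← mul_pow, this]
        rw [hnorm_re, pow_one] at hn
        apply hb
        have hk : (ℓ : ℝ) ^ k ≠ 0 := zpow_ne_zero k hℓR.ne'
        have : ‖b‖ ^ 2 = ((ℓ : ℝ) ^ (k - 1)) ^ 2 / (ℓ : ℝ) ^ k := by rw [← hn, mul_div_cancel_right₀ _ hk]
        rw [this, ← zpow_natCast, ← zpow_mul, div_eq_iff hk, ← zpow_add₀ hℓR.ne']
        congr 1
        push_cast
        ring
    · -- e = 2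
      have hr3 : r 3 = 0 := hrgt 3 (by norm_num)
      have h30 := h3 0
      rw [zero_add, hr3, zero_sub, neg_eq_zero, mul_eq_zero] at h30
      have hb0 : b = 0 := h30.resolve_right hre0
      rw [hb0, zero_mul, sub_zero] at h2
      by_cases hM : ellDvdM
      · rw [if_pos hM] at hdlt
        exact hre0 (h2.trans hdlt)
      · rw [if_neg hM] at hdlt
        rw [h2, hdlt, norm_zpow, Complex.norm_natCast, ← zpow_natCast, ← zpow_mul, ← zpow_natCast (ℓ : ℝ) 2,
          ← zpow_mul] at hnorm_re
        have := natCast_zpow_injective_real hℓ1 hnorm_re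
        omega
  · -- `e ≥ 3`
    obtain ⟨m, rfl⟩ : ∃ m, e = m + 3 := ⟨e - 3, by omega⟩
    have hA := h3 (m + 1)
    rw [show m + 1 + 3 = m + 4 from rfl, show m + 1 + 2 = m + 3 from rfl, hrgt (m + 4) (by omega), zero_sub,
      neg_eq_zero, mul_eq_zero] at hA
    have hb0 : b = 0 := hA.resolve_right hre0
    have hB := h3 m
    rw [hb0, zero_mul, sub_zero] at hB
    exact hre0 hB


/-- **The quotient of the functional equations, conjugate form.** As `coeff_relation_of_functionalEquations`, but with Hecke's
functional equation relating `g` to a form `g'` with the complex-conjugate Fourier coefficients: `Λ_N(g,s) = W·Λ_N(g',k−s)`.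
Since a newform on `Γ₀(M)` has REAL coefficients (`IsNewform0.conj_cuspCoeff`), `a(g') = c̄' ⋆ a(h)`, and the quotient gives
`c'_{Q/d} = C'·\overline{c'_d}·d^{−k}` for every `d ∣ Q`. [cite: Li1975, Thm. 9 (proof)] -/
private theorem coeff_relation_of_functionalEquations_conj {N M : ℕ} [NeZero N] [NeZero M] {k : ℤ}
    {g g' : CuspForm (Gamma0 N) k} {h : CuspForm (Gamma0 M) k} (hh : IsNewform0 h) {Q : ℕ} (hN : N = M * Q)
    {c' : ℕ → ℂ} (hsupp : ∀ n : ℕ, ¬ n ∣ Q → c' n = 0)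
    (hconv : ∀ n : ℕ, n ≠ 0 → cuspCoeff g n = (c' ⍟ cuspCoeff h) n)
    (hconj : ∀ n : ℕ, cuspCoeff g' n = (starRingEnd ℂ) (cuspCoeff g n))
    (hFE : ∃ (W : ℂ) (Λ Λ' : ℂ → ℂ), Λ ∈ completedCuspFormLContinuations N g ∧
      Λ' ∈ completedCuspFormLContinuations N g' ∧ ∀ s : ℂ, Λ s = W * Λ' (k - s)) :
    ∃ C' : ℂ, ∀ d ∈ Q.divisors, c' (Q / d) = C' * (starRingEnd ℂ) (c' d) * (d : ℂ) ^ (-(k : ℂ)) := by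
  classical
  have hQ0 : Q ≠ 0 := fun h0 ↦ NeZero.ne N (by rw [hN, h0, mul_zero])
  have hM0 : M ≠ 0 := NeZero.ne M
  have hQC : (Q : ℂ) ≠ 0 := by exact_mod_cast hQ0
  -- the conjugate coefficients `c̄'`
  set cb : ℕ → ℂ := fun n ↦ (starRingEnd ℂ) (c' n) with hcbdef
  have hsuppb : ∀ n : ℕ, ¬ n ∣ Q → cb n = 0 := fun n hn ↦ by rw [hcbdef]; simp only [hsupp n hn, map_zero]
  have hconvb : ∀ n : ℕ, n ≠ 0 → cuspCoeff g' n = (cb ⍟ cuspCoeff h) n := by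
    intro n hn
    rw [hconj n, hconv n hn, LSeries.convolution_def, LSeries.convolution_def, map_sum]
    refine Finset.sum_congr rfl fun x _ ↦ ?_
    rw [map_mul, hcbdef, hh.conj_cuspCoeff]
  -- both `P(s) = L(c', s)` and `P̄(s) = L(c̄', s)` are Dirichlet polynomials
  have hterm : ∀ (c : ℕ → ℂ), (∀ n : ℕ, ¬ n ∣ Q → c n = 0) → ∀ (s : ℂ) (n : ℕ), n ∉ Q.divisors →
      LSeries.term c s n = 0 := by
    intro c hc s n hn
    rcases eq_or_ne n 0 with rfl | hn0
    · exact LSeries.term_zero _ _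
    rw [LSeries.term_of_ne_zero hn0, hc n (fun hd ↦ hn (Nat.mem_divisors.mpr ⟨hd, hQ0⟩)), zero_div]
  have hPsum : ∀ (c : ℕ → ℂ), (∀ n : ℕ, ¬ n ∣ Q → c n = 0) → ∀ s : ℂ, LSeriesSummable c s :=
    fun c hc s ↦ summable_of_ne_finset_zero (hterm c hc s)
  have hPfin : ∀ (c : ℕ → ℂ), (∀ n : ℕ, ¬ n ∣ Q → c n = 0) → ∀ s : ℂ,
      LSeries c s = ∑ d ∈ Q.divisors, c d * (d : ℂ) ^ (-s) := by
    intro c hc s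
    rw [LSeries, tsum_eq_sum (hterm c hc s)]
    refine Finset.sum_congr rfl fun d hd ↦ ?_
    rw [LSeries.term_of_ne_zero (Nat.pos_of_mem_divisors hd).ne', div_eq_mul_inv, ← Complex.cpow_neg]
  have hPdiff : ∀ (c : ℕ → ℂ), (∀ n : ℕ, ¬ n ∣ Q → c n = 0) → Differentiable ℂ (LSeries c) := by
    intro c hc
    rw [show LSeries c = fun s ↦ ∑ d ∈ Q.divisors, c d * (d : ℂ) ^ (-s) from funext (hPfin c hc)]
    refine Differentiable.fun_sum fun d hd ↦ ?_
    have hd0 : (d : ℂ) ≠ 0 := by exact_mod_cast (Nat.pos_of_mem_divisors hd).ne'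
    exact fun s ↦ ((differentiableAt_id.neg.const_cpow (Or.inl hd0)).const_mul _)
  -- `L(g,s) = P(s)·L(h,s)`, `L(g',s) = P̄(s)·L(h,s)`
  have hLg : ∀ s : ℂ, (k : ℝ) / 2 + 1 < s.re →
      LSeries (cuspCoeff g) s = LSeries c' s * LSeries (cuspCoeff h) s := by
    intro s hs
    rw [LSeries_congr (f := cuspCoeff g) (g := c' ⍟ cuspCoeff h) (fun hn ↦ hconv _ hn) s]
    exact LSeries_convolution' (hPsum c' hsupp s) (LSeriesSummable_cuspCoeff_gamma0 h hs)
  have hLg' : ∀ s : ℂ, (k : ℝ) / 2 + 1 < s.re →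
      LSeries (cuspCoeff g') s = LSeries cb s * LSeries (cuspCoeff h) s := by
    intro s hs
    rw [LSeries_congr (f := cuspCoeff g') (g := cb ⍟ cuspCoeff h) (fun hn ↦ hconvb _ hn) s]
    exact LSeries_convolution' (hPsum cb hsuppb s) (LSeriesSummable_cuspCoeff_gamma0 h hs)
  -- the entire continuations
  obtain ⟨W, Λg, Λg', ⟨hΛg_diff, hΛg_eq⟩, ⟨hΛg'_diff, hΛg'_eq⟩, hFEg⟩ := hFE
  obtain ⟨Λh, ⟨hΛh_diff, hΛh_eq⟩, hFEh⟩ := IsNewform0.exists_functional_equation_holds hh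
  have hQpow_diff : Differentiable ℂ (fun s : ℂ ↦ (Q : ℂ) ^ (s / 2)) :=
    fun s ↦ (differentiableAt_id.div_const 2).const_cpow (Or.inl hQC)
  -- `Λ_N(g,s) = Q^{s/2}P(s)Λ_M(h,s)` and `Λ_N(g',s) = Q^{s/2}P̄(s)Λ_M(h,s)`
  have hcont : ∀ (gg : CuspForm (Gamma0 N) k) (c : ℕ → ℂ) (hc : ∀ n : ℕ, ¬ n ∣ Q → c n = 0)
      (hL : ∀ s : ℂ, (k : ℝ) / 2 + 1 < s.re → LSeries (cuspCoeff gg) s = LSeries c s * LSeries (cuspCoeff h) s)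
      (Λ : ℂ → ℂ) (hΛ : Λ ∈ completedCuspFormLContinuations N gg),
      Λ = fun s ↦ (Q : ℂ) ^ (s / 2) * LSeries c s * Λh s := by
    intro gg c hc hL Λ hΛ
    refine subsingleton_completedCuspFormLContinuations N gg hΛ ⟨(hQpow_diff.mul (hPdiff c hc)).mul hΛh_diff, ?_⟩
    intro s hs
    simp only [completedCuspFormL, cuspFormLSeries]
    rw [hΛh_eq s hs, hL s hs]
    simp only [completedCuspFormL, cuspFormLSeries]
    rw [hN, Nat.cast_mul, Complex.natCast_mul_natCast_cpow]
    ring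
  have hΛgE := hcont g c' hsupp hLg Λg ⟨hΛg_diff, hΛg_eq⟩
  have hΛg'E := hcont g' cb hsuppb hLg' Λg' ⟨hΛg'_diff, hΛg'_eq⟩
  -- `Λ_M(h,·)` is not identically zero
  have hΛh_ne : ∃ s₀, Λh s₀ ≠ 0 := by
    by_contra hall
    have hall' : ∀ s, Λh s = 0 := fun s ↦ not_not.mp (not_exists.mp hall s)
    have hzero : (fun x : ℝ ↦ LSeries (cuspCoeff h) x) =ᶠ[Filter.atTop] 0 := by
      filter_upwards [Filter.eventually_gt_atTop ((k : ℝ) / 2 + 1), Filter.eventually_gt_atTop (0 : ℝ)]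
        with x hx hx0
      have hx' : (k : ℝ) / 2 + 1 < (x : ℂ).re := by rwa [Complex.ofReal_re]
      have h0 := hΛh_eq x hx'
      rw [hall'] at h0
      simp only [completedCuspFormL, cuspFormLSeries] at h0
      have h1 : (M : ℂ) ^ ((x : ℂ) / 2) ≠ 0 := by
        rw [Ne, Complex.cpow_eq_zero_iff, not_and_or]
        exact Or.inl (by exact_mod_cast hM0)
      have h2 : (2 * Real.pi : ℂ) ^ (-(x : ℂ)) ≠ 0 := by
        rw [Ne, Complex.cpow_eq_zero_iff, not_and_or]
        exact Or.inl (by exact_mod_cast (by positivity : (2 * Real.pi : ℝ) ≠ 0))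
      have h3 : Complex.Gamma (x : ℂ) ≠ 0 := Complex.Gamma_ne_zero_of_re_pos (by rwa [Complex.ofReal_re])
      simp only [Pi.zero_apply]
      have := h0.symm
      rw [mul_eq_zero, mul_eq_zero, mul_eq_zero] at this
      rcases this with ((h | h) | h) | h
      · exact absurd h h1
      · exact absurd h h2
      · exact absurd h h3
      · exact h
    rcases LSeries_eventually_eq_zero_iff'.mp hzero with hcoef | htop
    · exact one_ne_zero ((hh.2.2).symm.trans (hcoef 1 one_ne_zero))
    · have hsum := LSeriesSummable_cuspCoeff_gamma0 h (s := (((k : ℝ) / 2 + 2 : ℝ) : ℂ))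
        (by rw [Complex.ofReal_re]; linarith)
      have hle := hsum.abscissaOfAbsConv_le
      rw [htop, top_le_iff] at hle
      exact EReal.coe_ne_top _ hle
  obtain ⟨s₀, hs₀⟩ := hΛh_ne
  -- `F(s) = Q^{s/2}P(s) − C·Q^{(k−s)/2}P̄(k−s)` vanishes identically
  set C : ℂ := W * Complex.I ^ k * frickeEigenvalue h with hCdef
  set F : ℂ → ℂ := fun s ↦ (Q : ℂ) ^ (s / 2) * LSeries c' s -
    C * ((Q : ℂ) ^ (((k : ℂ) - s) / 2) * LSeries cb ((k : ℂ) - s)) with hFdef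
  have hcomp : Differentiable ℂ (fun s : ℂ ↦ (k : ℂ) - s) := (differentiable_const _).sub differentiable_id
  have hF_diff : Differentiable ℂ F :=
    (hQpow_diff.mul (hPdiff c' hsupp)).sub (((hQpow_diff.comp hcomp).mul ((hPdiff cb hsuppb).comp hcomp)).const_mul C)
  have hFΛ : ∀ s, F s * Λh s = 0 := by
    intro s
    have h1 : Λg s = W * Λg' ((k : ℂ) - s) := hFEg s
    have h2 : Λh ((k : ℂ) - s) = Complex.I ^ k * frickeEigenvalue h * Λh s := by
      have := hFEh ((k : ℂ) - s)
      rwa [sub_sub_cancel] at this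
    rw [hΛgE, hΛg'E] at h1
    simp only at h1
    rw [h2] at h1
    simp only [hFdef, hCdef]
    linear_combination h1
  have hF0 : ∀ s, F s = 0 := by
    have hev : F =ᶠ[nhds s₀] 0 := by
      have hne : ∀ᶠ s in nhds s₀, Λh s ≠ 0 := hΛh_diff.continuous.continuousAt.eventually_ne hs₀
      filter_upwards [hne] with s hs
      exact (mul_eq_zero.mp (hFΛ s)).resolve_right hs
    have hEqOn := (hF_diff.differentiableOn.analyticOnNhd isOpen_univ).eqOn_zero_of_preconnected_of_eventuallyEq_zero
      isPreconnected_univ (Set.mem_univ s₀) hev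
    exact fun s ↦ hEqOn (Set.mem_univ s)
  -- `Q^s P(s) = C'·P̄(k−s)`
  set C' : ℂ := C * (Q : ℂ) ^ ((k : ℂ) / 2) with hC'def
  have hQs : ∀ s : ℂ, (Q : ℂ) ^ s * LSeries c' s = C' * LSeries cb ((k : ℂ) - s) := by
    intro s
    have h0 : (Q : ℂ) ^ (s / 2) * LSeries c' s = C * ((Q : ℂ) ^ (((k : ℂ) - s) / 2) * LSeries cb ((k : ℂ) - s)) :=
      sub_eq_zero.mp (hF0 s)
    have hsplit : (Q : ℂ) ^ s = (Q : ℂ) ^ (s / 2) * (Q : ℂ) ^ (s / 2) := by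
      rw [← Complex.cpow_add _ _ hQC]; ring_nf
    have hsplit' : (Q : ℂ) ^ (s / 2) * (Q : ℂ) ^ (((k : ℂ) - s) / 2) = (Q : ℂ) ^ ((k : ℂ) / 2) := by
      rw [← Complex.cpow_add _ _ hQC]; ring_nf
    calc (Q : ℂ) ^ s * LSeries c' s = (Q : ℂ) ^ (s / 2) * ((Q : ℂ) ^ (s / 2) * LSeries c' s) := by
          rw [hsplit, mul_assoc]
      _ = (Q : ℂ) ^ (s / 2) * (C * ((Q : ℂ) ^ (((k : ℂ) - s) / 2) * LSeries cb ((k : ℂ) - s))) := by rw [h0]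
      _ = C' * LSeries cb ((k : ℂ) - s) := by rw [hC'def, ← hsplit']; ring
  -- `Σ_{d∣Q} (c'_{Q/d} − C' c̄'_d d^{−k}) d^{s} ≡ 0`
  set α : ℕ → ℂ := fun d ↦ if d ∈ Q.divisors then c' (Q / d) - C' * cb d * (d : ℂ) ^ (-(k : ℂ)) else 0 with hαdef
  have hαsum : ∀ s : ℂ, ∑ d ∈ Q.divisors, α d * (d : ℂ) ^ s = 0 := by
    intro s
    have hL := hQs s
    rw [hPfin c' hsupp s, hPfin cb hsuppb ((k : ℂ) - s), Finset.mul_sum, Finset.mul_sum] at hL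
    have hlhs : ∑ d ∈ Q.divisors, (Q : ℂ) ^ s * (c' d * (d : ℂ) ^ (-s)) =
        ∑ d ∈ Q.divisors, c' (Q / d) * (d : ℂ) ^ s := by
      rw [← Nat.sum_div_divisors Q (fun d ↦ c' (Q / d) * (d : ℂ) ^ s)]
      refine Finset.sum_congr rfl fun d hd ↦ ?_
      obtain ⟨hdQ, -⟩ := Nat.mem_divisors.mp hd
      have hd0 : (d : ℂ) ≠ 0 := by exact_mod_cast (Nat.pos_of_mem_divisors hd).ne'
      have hds : (d : ℂ) ^ s ≠ 0 := by
        rw [Ne, Complex.cpow_eq_zero_iff, not_and_or]; exact Or.inl hd0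
      rw [Nat.div_div_self hdQ hQ0]
      have hQd : (Q : ℂ) = (d : ℂ) * ((Q / d : ℕ) : ℂ) := by rw [← Nat.cast_mul, Nat.mul_div_cancel' hdQ]
      rw [hQd, Complex.natCast_mul_natCast_cpow, Complex.cpow_neg]
      field_simp
    have hrhs : ∑ d ∈ Q.divisors, C' * (cb d * (d : ℂ) ^ (-((k : ℂ) - s))) =
        ∑ d ∈ Q.divisors, C' * cb d * (d : ℂ) ^ (-(k : ℂ)) * (d : ℂ) ^ s := by
      refine Finset.sum_congr rfl fun d hd ↦ ?_
      have hd0 : (d : ℂ) ≠ 0 := by exact_mod_cast (Nat.pos_of_mem_divisors hd).ne'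
      rw [show -((k : ℂ) - s) = -(k : ℂ) + s by ring, Complex.cpow_add _ _ hd0]
      ring
    rw [hlhs, hrhs, ← sub_eq_zero, ← Finset.sum_sub_distrib] at hL
    rw [← hL]
    refine Finset.sum_congr rfl fun d hd ↦ ?_
    rw [hαdef]
    simp only [if_pos hd]
    ring
  have hα0 : α 0 = 0 := by
    rw [hαdef]
    simp only [Nat.mem_divisors, zero_dvd_iff, hQ0, false_and, if_false]
  have hαterm : ∀ (s : ℂ) (n : ℕ), n ∉ Q.divisors → LSeries.term α s n = 0 := by
    intro s n hn
    rcases eq_or_ne n 0 with rfl | hn0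
    · exact LSeries.term_zero _ _
    rw [LSeries.term_of_ne_zero hn0, hαdef]
    simp only [hn, if_false, zero_div]
  have hLα : LSeries α = 0 := by
    funext s
    rw [LSeries, tsum_eq_sum (hαterm s), Pi.zero_apply, ← hαsum (-s)]
    refine Finset.sum_congr rfl fun d hd ↦ ?_
    rw [LSeries.term_of_ne_zero (Nat.pos_of_mem_divisors hd).ne', div_eq_mul_inv, ← Complex.cpow_neg]
  have hαabs : LSeries.abscissaOfAbsConv α ≠ ⊤ := by
    have hs : LSeriesSummable α 0 := summable_of_ne_finset_zero (hαterm 0)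
    have hle := hs.abscissaOfAbsConv_le
    intro htop
    rw [htop, top_le_iff, Complex.zero_re] at hle
    exact EReal.coe_ne_top _ hle
  have hαzero : α = 0 := ((LSeries_eq_zero_iff hα0).mp hLα).resolve_right hαabs
  refine ⟨C', fun d hd ↦ ?_⟩
  have := congrFun hαzero d
  rw [hαdef] at this
  simp only [if_pos hd, Pi.zero_apply, sub_eq_zero] at this
  exact this

/-- ★ **The level of an eigenform satisfying Hecke's functional equation `Λ_N(g,s) = W·Λ_N(g^ρ, k−s)` against its CONJUGATE
form is the level of its newform** (Li 1975, Thm. 9; Miyake Thm. 4.6.17): as `level_eq_of_functionalEquation`, but the functional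
equation relates the entire continuation of `Λ_N(g,·)` to that of `Λ_N(g',·)` for a form `g' ∈ S_k(Γ₀(N))` with the
complex-conjugate Fourier coefficients `a_n(g') = \overline{a_n(g)}` (the shape of Hecke's `Λ(χ,s) = W·Λ(χ̄, k−s)` for the theta
series of a Größencharakter; for `Γ₀(N)`-newforms `g^ρ = g`).  The proof is that of the self-dual case with `‖c_{ℓ^e}‖² = ℓ^{ke}`
in place of `c_{ℓ^e}² = ℓ^{ke}`. [cite: Li1975, Thm. 3 and Thm. 9] [cite: AtkinLehner1970, Thms. 3–5] -/
theorem level_eq_of_functionalEquation_conj {N M : ℕ} [NeZero N] [NeZero M] {k : ℤ}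
    {g g' : CuspForm (Gamma0 N) k} {h : CuspForm (Gamma0 M) k} (hh : IsNewform0 h) (hMN : M ∣ N)
    (hT : ∀ (p : ℕ) (hp : p.Prime), ¬ p ∣ N → (haveI : NeZero p := ⟨hp.ne_zero⟩; heckeT (Gamma0 N) k p g) = cuspCoeff h p • g)
    (h1 : cuspCoeff g 1 = 1)
    (hmul : ∀ m n : ℕ, m.Coprime n → cuspCoeff g (m * n) = cuspCoeff g m * cuspCoeff g n)
    (hpow : ∀ ℓ : ℕ, ℓ.Prime → ℓ ∣ N → ∀ j : ℕ, cuspCoeff g (ℓ ^ j) = cuspCoeff g ℓ ^ j)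
    (hnorm : ∀ ℓ : ℕ, ℓ.Prime → ℓ ∣ N → ‖cuspCoeff g ℓ‖ ^ 2 ≠ (ℓ : ℝ) ^ (k - 2))
    (hconj : ∀ n : ℕ, cuspCoeff g' n = (starRingEnd ℂ) (cuspCoeff g n))
    (hFE : ∃ (W : ℂ) (Λ Λ' : ℂ → ℂ), Λ ∈ completedCuspFormLContinuations N g ∧
      Λ' ∈ completedCuspFormLContinuations N g' ∧ ∀ s : ℂ, Λ s = W * Λ' (k - s)) :
    N = M := by
  classical
  set Q : ℕ := N / M with hQdef
  have hN : N = M * Q := (Nat.mul_div_cancel' hMN).symm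
  have hQ0 : Q ≠ 0 := fun h0 ↦ NeZero.ne N (by rw [hN, h0, mul_zero])
  have hh1 : cuspCoeff h 1 = 1 := hh.2.2
  -- Step 1: the Atkin–Lehner span, coefficient form
  obtain ⟨c, hc⟩ := exists_cuspCoeff_eq_sum_of_eigenpacket hMN hh hT
  set c₀ : ℕ → ℂ := fun d ↦ if d ∈ Q.divisors then c d else 0 with hc₀def
  have hc1 : c 1 = 1 := by
    have h := hc 1
    rw [h1, Finset.sum_eq_single 1] at h
    · simpa [hh1] using h.symm
    · intro d _ hd1
      rw [if_neg (fun h1d ↦ hd1 (Nat.dvd_one.mp h1d)), mul_zero]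
    · intro h1'
      exact absurd (Nat.one_mem_divisors.mpr hQ0) h1'
  have hc₀1 : c₀ 1 = 1 := by
    rw [hc₀def]
    simp only [Nat.one_mem_divisors.mpr hQ0, if_true, hc1]
  have hkey : ∀ (p e : ℕ), p.Prime → ∀ F : ℕ → ℂ,
      ∑ d ∈ Q.divisors, (if d ∣ p ^ e then F d else 0) = ∑ i ∈ range (e + 1), (if p ^ i ∣ Q then F (p ^ i) else 0) := by
    intro p e hp F
    have hpe : p ^ e ≠ 0 := pow_ne_zero _ hp.ne_zero
    calc ∑ d ∈ Q.divisors, (if d ∣ p ^ e then F d else 0)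
        = ∑ d ∈ Q.divisors with d ∣ p ^ e, F d := (Finset.sum_filter _ _).symm
      _ = ∑ d ∈ (p ^ e).divisors with d ∣ Q, F d := by
          refine Finset.sum_congr ?_ fun _ _ ↦ rfl
          ext d
          simp only [Finset.mem_filter, Nat.mem_divisors]
          constructor
          · rintro ⟨⟨hdQ, -⟩, hdp⟩; exact ⟨⟨hdp, hpe⟩, hdQ⟩
          · rintro ⟨⟨hdp, -⟩, hdQ⟩; exact ⟨⟨hdQ, hQ0⟩, hdp⟩
      _ = ∑ d ∈ (p ^ e).divisors, (if d ∣ Q then F d else 0) := Finset.sum_filter _ _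
      _ = ∑ i ∈ range (e + 1), (if p ^ i ∣ Q then F (p ^ i) else 0) := by
          rw [Nat.divisors_prime_pow hp, Finset.sum_map]
          rfl
  have hpp : ∀ p e : ℕ, p.Prime →
      cuspCoeff g (p ^ e) = ∑ i ∈ range (e + 1), c₀ (p ^ i) * cuspCoeff h (p ^ (e - i)) := by
    intro p e hp
    rw [hc (p ^ e)]
    have hstep : ∑ d ∈ Q.divisors, c d * (if d ∣ p ^ e then cuspCoeff h (p ^ e / d) else 0) =
        ∑ d ∈ Q.divisors, (if d ∣ p ^ e then c d * cuspCoeff h (p ^ e / d) else 0) :=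
      Finset.sum_congr rfl fun d _ ↦ by split_ifs <;> simp
    rw [hstep, hkey p e hp]
    refine Finset.sum_congr rfl fun i hi ↦ ?_
    have hi' : i ≤ e := Nat.lt_succ_iff.mp (mem_range.mp hi)
    rw [Nat.pow_div hi' hp.pos, hc₀def]
    simp only [Nat.mem_divisors, hQ0, ne_eq, not_false_eq_true, and_true]
    split_ifs <;> simp
  -- Step 2: multiplicativity
  have ha : ArithmeticFunction.IsMultiplicative (toArithmeticFunction (cuspCoeff g)) := by
    refine ⟨by simp [toArithmeticFunction, h1], fun {m n} hmn ↦ ?_⟩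
    rcases eq_or_ne m 0 with rfl | hm
    · simp [toArithmeticFunction]
    rcases eq_or_ne n 0 with rfl | hn
    · simp [toArithmeticFunction]
    simp only [toArithmeticFunction, ArithmeticFunction.coe_mk, hm, hn, mul_ne_zero hm hn, if_false]
    exact hmul m n hmn
  have hb : ArithmeticFunction.IsMultiplicative (toArithmeticFunction (cuspCoeff h)) := by
    refine ⟨by simp [toArithmeticFunction, hh1], fun {m n} hmn ↦ ?_⟩
    rcases eq_or_ne m 0 with rfl | hm
    · simp [toArithmeticFunction]
    rcases eq_or_ne n 0 with rfl | hn
    · simp [toArithmeticFunction]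
    simp only [toArithmeticFunction, ArithmeticFunction.coe_mk, hm, hn, mul_ne_zero hm hn, if_false]
    exact IsNewform0.coeff_mul_of_coprime_holds hh hmn
  obtain ⟨c', hc'm, hc'0, hc'p, hconv⟩ := exists_isMultiplicative_convolution_eq ha hb hc₀1 hpp
  have hsuppQ : ∀ n : ℕ, ¬ n ∣ Q → c' n = 0 := by
    intro n hn
    rcases eq_or_ne n 0 with rfl | hn0
    · exact hc'0
    by_contra hne
    refine hn (dvd_of_isMultiplicative_ne_zero hc'm hQ0 (fun p e hp _ hpe ↦ ?_) hn0 hne)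
    rw [hc'p p e hp, hc₀def]
    simp only [Nat.mem_divisors, hpe, false_and, if_false]
  have hc'1 : c' 1 = 1 := by
    have := hc'p 2 0 Nat.prime_two
    rw [pow_zero] at this
    rw [this, hc₀1]
  -- Step 3: the functional equation gives `c'_{Q/d} = C'·\overline{c'_d}·d^{−k}`
  obtain ⟨C', hrel⟩ := coeff_relation_of_functionalEquations_conj hh hN hsuppQ hconv hconj hFE
  have hCQ : c' Q = C' := by
    have := hrel 1 (Nat.one_mem_divisors.mpr hQ0)
    rwa [Nat.div_one, hc'1, map_one, mul_one, Nat.cast_one, Complex.one_cpow, mul_one] at this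
  -- Step 4: every prime exponent of `Q` vanishes
  have hfac : ∀ ℓ : ℕ, ℓ.Prime → Q.factorization ℓ = 0 := by
    intro ℓ hℓ
    by_contra hne
    have he : 0 < Q.factorization ℓ := Nat.pos_of_ne_zero hne
    set e : ℕ := Q.factorization ℓ with hedef
    have hℓC : (ℓ : ℂ) ≠ 0 := by exact_mod_cast hℓ.ne_zero
    have hℓe : ℓ ^ e ∣ Q := Nat.ordProj_dvd Q ℓ
    have hcop : Nat.Coprime (ℓ ^ e) (Q / ℓ ^ e) := (Nat.coprime_ordCompl hℓ hQ0).pow_left e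
    have hQsplit : ℓ ^ e * (Q / ℓ ^ e) = Q := Nat.ordProj_mul_ordCompl_eq_self Q ℓ
    have hmulQ : c' Q = c' (ℓ ^ e) * c' (Q / ℓ ^ e) := by
      have hm := hc'm.map_mul_of_coprime hcop
      rw [hQsplit] at hm
      have h1' : ℓ ^ e ≠ 0 := pow_ne_zero _ hℓ.ne_zero
      have h2' : Q / ℓ ^ e ≠ 0 := (Nat.ordCompl_pos ℓ hQ0).ne'
      simpa only [toArithmeticFunction, ArithmeticFunction.coe_mk, hQ0, h1', h2', if_false] using hm
    have hrel_e := hrel (ℓ ^ e) (Nat.mem_divisors.mpr ⟨hℓe, hQ0⟩)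
    -- `‖c'(ℓ^e)‖² = ℓ^{ke}`
    have hre : ‖c' (ℓ ^ e)‖ ^ 2 = ((ℓ : ℝ) ^ e) ^ k := by
      have hX : ((ℓ ^ e : ℕ) : ℂ) ^ (-(k : ℂ)) = (((ℓ : ℂ) ^ e) ^ k)⁻¹ := by
        rw [Complex.cpow_neg, Complex.cpow_intCast, Nat.cast_pow]
      have hpowk : ((ℓ : ℂ) ^ e) ^ k ≠ 0 := zpow_ne_zero k (pow_ne_zero e hℓC)
      have hC'0 : C' ≠ 0 := by
        intro h0
        have := hrel Q (Nat.mem_divisors_self Q hQ0)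
        rw [Nat.div_self (Nat.pos_of_ne_zero hQ0), hc'1, h0, zero_mul, zero_mul] at this
        exact one_ne_zero this
      have h := hCQ
      rw [hmulQ, hrel_e, hX] at h
      -- `c'(ℓ^e) * (C' * conj (c'(ℓ^e)) * ((ℓ^e)^k)⁻¹) = C'`, i.e. `c'·c̄' = (ℓ^e)^k`
      have hcc : c' (ℓ ^ e) * (starRingEnd ℂ) (c' (ℓ ^ e)) = ((ℓ : ℂ) ^ e) ^ k := by
        field_simp at h
        linear_combination h
      have := congrArg norm hcc
      rw [norm_mul, Complex.norm_conj, norm_zpow, norm_pow, Complex.norm_natCast, ← pow_two] at this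
      exact this
    -- the local identities and the contradiction
    have hℓQ : ℓ ∣ Q := (dvd_pow_self ℓ he.ne').trans hℓe
    have hℓN : ℓ ∣ N := hℓQ.trans ⟨M, by rw [hN, mul_comm]⟩
    obtain ⟨hI, hII, hIII⟩ := local_coeff_identities (r := fun i ↦ c' (ℓ ^ i))
      (aG := fun n ↦ cuspCoeff g (ℓ ^ n)) (aH := fun n ↦ cuspCoeff h (ℓ ^ n))
      (a := cuspCoeff h ℓ) (b := cuspCoeff g ℓ) (dlt := if ℓ ∣ M then 0 else (ℓ : ℂ) ^ (k - 1))
      (fun n ↦ by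
        rw [hconv _ (pow_ne_zero n hℓ.ne_zero), LSeries.convolution_def]
        exact sum_divisorsAntidiagonal_prime_pow hℓ n (fun x ↦ c' x.1 * cuspCoeff h x.2))
      (fun n ↦ hpow ℓ hℓ hℓN n) (by simp [hh1]) (by simp)
      (fun n ↦ hh.cuspCoeff_prime_pow_add_two_weight hℓ n)
    refine local_contradiction_of_norm hℓ he (ℓ ∣ M) (by simp [hc'1]) (fun j hj ↦ hsuppQ _ fun hdvd ↦ ?_) hre hI hII hIII rfl
      (fun hℓM ↦ ?_) (hnorm ℓ hℓ hℓN)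
    · have := (hℓ.pow_dvd_iff_le_factorization hQ0).mp hdvd
      omega
    · by_cases h2 : ℓ ^ 2 ∣ M
      · exact Or.inl (hh.cuspCoeff_eq_zero_of_sq_dvd hℓ h2)
      · exact Or.inr (hh.norm_cuspCoeff_sq_eq_zpow_of_dvd_of_not_sq_dvd hℓ hℓM h2)
  -- Step 5: `Q = 1`
  have hQ1 : Q = 1 := by
    have hzero : Q.factorization = 0 := Finsupp.ext fun ℓ ↦ by
      by_cases hℓ : ℓ.Prime
      · exact hfac ℓ hℓ
      · exact Nat.factorization_eq_zero_of_not_prime Q hℓ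
    rcases (Nat.factorization_eq_zero_iff' Q).mp hzero with h0 | h0
    · exact absurd h0 hQ0
    · exact h0
  rw [hN, hQ1, mul_one]

/-- ★★ **Li's criterion, conjugate form**: under the hypotheses of `level_eq_of_functionalEquation_conj` (the functional equation of
`Λ_N(g,·)` against `Λ_N(g^ρ,·)`), `g` is the newform `h`; in particular `IsNewform0 g`. [cite: Li1975, Thm. 9] [cite: Miyake2006, Thm. 4.6.17] -/
theorem isNewform0_of_functionalEquation_conj {N M : ℕ} [NeZero N] [NeZero M] {k : ℤ}
    {g g' : CuspForm (Gamma0 N) k} {h : CuspForm (Gamma0 M) k} (hh : IsNewform0 h) (hMN : M ∣ N)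
    (hT : ∀ (p : ℕ) (hp : p.Prime), ¬ p ∣ N → (haveI : NeZero p := ⟨hp.ne_zero⟩; heckeT (Gamma0 N) k p g) = cuspCoeff h p • g)
    (h1 : cuspCoeff g 1 = 1)
    (hmul : ∀ m n : ℕ, m.Coprime n → cuspCoeff g (m * n) = cuspCoeff g m * cuspCoeff g n)
    (hpow : ∀ ℓ : ℕ, ℓ.Prime → ℓ ∣ N → ∀ j : ℕ, cuspCoeff g (ℓ ^ j) = cuspCoeff g ℓ ^ j)
    (hnorm : ∀ ℓ : ℕ, ℓ.Prime → ℓ ∣ N → ‖cuspCoeff g ℓ‖ ^ 2 ≠ (ℓ : ℝ) ^ (k - 2))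
    (hconj : ∀ n : ℕ, cuspCoeff g' n = (starRingEnd ℂ) (cuspCoeff g n))
    (hFE : ∃ (W : ℂ) (Λ Λ' : ℂ → ℂ), Λ ∈ completedCuspFormLContinuations N g ∧
      Λ' ∈ completedCuspFormLContinuations N g' ∧ ∀ s : ℂ, Λ s = W * Λ' (k - s)) :
    IsNewform0 g := by
  obtain rfl : N = M := level_eq_of_functionalEquation_conj hh hMN hT h1 hmul hpow hnorm hconj hFE
  rw [eq_newform_of_eigenpacket hh hT h1]
  exact hh

end Literature.NumberTheory.EllipticCurves.ModularForms

end
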